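import Mathlib.Analysis.Meromorphic.NormalForm
import Mathlib.Analysis.Complex.RemovableSingularity
import Mathlib.Analysis.Complex.AbsMax
import Literature.NumberTheory.LFunctions.ZetaZerosProofs
import Literature.NumberTheory.LFunctions.TrivialZerosSimple
import Literature.NumberTheory.LFunctions.BurnolLPropertyProofs
import Literature.NumberTheory.LFunctions.BurnolResidueExpansionPointwiseProofs
import Literature.NumberTheory.LFunctions.InvZetaPolynomialHeights
import Literature.NumberTheory.LFunctions.BurnolZetaQuotientCompletenessProofs
import Literature.NumberTheory.LFunctions.BurnolEvaluatorsMinimal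
import Literature.NumberTheory.LFunctions.BurnolEvaluatorProofs
import Literature.NumberTheory.LFunctions.RHWave0HardyProofs
import Literature.Analysis.Complex.PolynomialGrowthLiouville
import HarnessLib

/-!
# Burnol 2004b, Props. 6.1 and 6.2: completeness of the evaluators `Y^a_{ρ,k}` in `L_a`, `a ≥ 1`

LINE 1 — LABEL: RH-FREE (Hilbert-space completeness of a system of vectors indexed by the non-trivial
zeros of `ζ`, WHEREVER they lie; the only input about `ζ` beyond its functional equation is
Titchmarsh's Theorem 9.7, `|1/ζ(σ ± iT)| ≤ T^A` on `−1 ≤ σ ≤ 2` at a height in every unit interval,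
an unconditional theorem of the tree). FRAMING (cell rh-crit, D-0074): corpus theorems are RH-FREE
literature; nothing here is worded as progress toward RH. bears_on: B-C/B-P (LADDER-RH COLUMN 6, de
Branges framework — [Burnol2004b] §6, the constituents of Thm. 3.1). WHAT THIS IS NOT: not a route,
not a criterion, no positivity; discharging two as-printed structural propositions of an RH-criterion
corpus fixes corpus vocabulary and moves RH by nothing. Nothing here bears on the truth of RH.

Source. J.-F. Burnol, *Two complete and minimal systems associated with the zeros of the Riemann zeta
function*, J. Théor. Nombres Bordeaux **16** (2004) 65–94 = arXiv:math/0203120v7 [Burnol2004b], §6,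
Props. 6.1 and 6.2 (p. 15; TeX of record `rh-crit/dbl/src/Burnol2004JTNB_arXivmath0203120v7.tex`
l.1203–1257):

> **Proposition 6.1.** Let `a ≥ 1`. The vectors `Y^a_{ρ,k}` associated with the non-trivial zeros of
> the Riemann zeta function are complete in `L_a`.
> **Proposition 6.2.** Let `a > 1`. The vectors `Y^a_{ρ,k}` associated with the non-trivial zeros of
> the Riemann zeta function are not minimal: indeed they remain a complete system in `L_a` even after
> omitting arbitrarily finitely many among them.

Printed proof (TeX l.1208–1257): if `g ∈ L_a` is perpendicular to all `Y^a_{ρ,k}` then its continued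
right Mellin transform factorizes as `G(s) = ζ(s)θ(s)` with `θ` ENTIRE ("`G` shares with `ζ` its
trivial zeros and has at most a pole of order `1` at `s = 1`"); `θ` is Nevanlinna in `Re s > 1/2` and,
by the functional equation `θ(1−s) = 𝓕₊(g)^(s)/ζ(s)`, in `Re s < 1/2`; by KREĬN's theorem `θ` has
finite exponential type `max(limsup log|θ(σ)|/σ, limsup log|θ(1−σ)|/σ) < 0` for `a > 1`
("`G(s)/ζ(s)` is `O(A^{Re s})` in `Re s ≥ 2`", `A = 1/a`), so `θ = 0`; for `a = 1`, minimal type and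
`L²` on `Re s = 2` give `θ = 0` by Paley–Wiener. Prop. 6.2: the same with
`G(s) = ζ(s)θ(s)/∏_{ρ∈R}(s−ρ)^{m_ρ}`.

## What is PROVED (theorem-only module: no definition, no new named fact; net debt −2)

* `Burnol2004b_prop6_1_holds : Burnol2004b_prop6_1`, `Burnol2004b_prop6_2_holds : Burnol2004b_prop6_2`
  — the DISCHARGES of the two named facts of `BurnolZetaSystems.lean`.
* The engine (namespace `BurnolEvaluatorCompleteness`), for `f ∈ L_a`, `a ≥ 1`, and a polynomial
  weight `P` (here `P_R(s) = ∏_{ρ∈R}(s−ρ)^{m_ρ}`): `exists_entire_of_meromorphicOrderAt_le` (division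
  in the ring of entire functions, by meromorphic orders — Mathlib's normal form `toMeromorphicNFOn`),
  `exists_theta` (`θ = G_f·P/ζ` is entire when `G_f` vanishes on the non-trivial zeros outside `R` to
  the order of `ζ`), `exists_bound_theta_right` / `_left` (functional equations) / `_strip` (Titchmarsh
  9.7 rectangles), `eq_zero_of_growth_of_tendsto` (an entire function of polynomial growth tending
  to `0` along the real axis is `0`), `rightMellinExt_eq_zero_of_vanishing` (`G_f ≡ 0`),
  `eq_zero_of_rightMellinExt_eq_zero` (Mellin–Plancherel injectivity), `eq_zero_of_orthogonal`,
  `sonineL_subset_closure_span` (orthogonal projection inside the closed subspace `L_a`).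

## DECLARED DEVIATION from the printed proof (same statements, different route to `θ = 0`)

Kreĭn's theorem (an entire function Nevanlinna in two complementary half-planes is of exponential
type, with the type formula) is NOT in the tree. It is replaced by an elementary argument giving
POLYNOMIAL GROWTH of `θ` directly:
(1) on `Re s ≥ 2`, `|G_f| ≤ C` (the `ℍ²` structure `G_f(s) = c·a^{1−s}/(1−s) + ∫_a^∞ f t^{−s}`, dbl-iso g5's
    `BurnolLProperty.norm_rightMellinExt_le_of_re_gt_half`) and `|1/ζ| ≤ Σk^{−2}`;
(2) on `Re s ≤ −1`, both functional equations (`G_f(s) = Γ_ℝ(1−s)/Γ_ℝ(s)·G_{𝓕f}(1−s)`, Prop. 2.2 (v), and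
    `Λ(s) = Λ(1−s)`) give `θ(s) = G_{𝓕f}(1−s)P(s)/ζ(1−s)` — exactly the printed "`θ(1−s) = 𝓕₊(g)^(s)/ζ(s)`";
    the trivial zeros are reached by continuity;
(3) in the strip `−1 ≤ Re s ≤ 2`: the L-Property of `G_f` (Thm. 4.8, `Burnol2004b_thm4_8_holds`) and
    Titchmarsh's Theorem 9.7 (`InvZetaPoly.exists_norm_inv_zeta_le_rpow`; a zero-free good line by
    `zeta_ne_zero_of_norm_inv_le`) bound `θ` polynomially on the boundary of the rectangles
    `[−1,2] × [T_lo, T_hi]` between consecutive good heights, hence inside (maximum modulus);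
(4) so `θ` is an entire function of polynomial growth, i.e. a polynomial (Liouville,
    `Literature.Analysis.Complex.exists_eq_sum_of_differentiable_of_growth`), and `θ(σ) → 0` as the real
    `σ → +∞` (`|G_f(σ)| ≤ |c|a^{1−σ}/(σ−1) + √(a^{1−2σ}/(2σ−1))(‖f‖²+1)/2`; for `a > 1` this beats the
    weight, for `a = 1` the weight is trivial) forces `θ = 0`. For `a = 1` this also replaces the
    printed Paley–Wiener step.
Then `G_f ≡ 0` off `s = 1` (identity theorem), `f = 0` (Mellin–Plancherel on the critical line,
`BurnolZetaQuotientCompleteness.mellinL2_resPos_ae_eq`), and completeness follows by orthogonal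
projection onto the closed span inside `L_a` (`⟪Y^a_{ρ,k}, g⟫ = 0 ⇔ M(ḡ)^{(k)}(ρ) = 0`). Non-minimality
in Prop. 6.2: completeness after omitting one vector (an index exists: Hardy's theorem,
`Hardy.riemannZeta_zeros_on_critical_line_infinite`).

## References
* [Burnol2004b] J.-F. Burnol, JTNB 16 (2004) = arXiv:math/0203120v7, §6 Props. 6.1, 6.2 (p. 15,
  TeX l.1203–1257); Prop. 2.2 (p. 5, TeX l.460–469); Thm. 4.8 (p. 9, TeX l.831–884).
* [Titchmarsh1986] E. C. Titchmarsh, *The Theory of the Riemann Zeta-Function*, 2nd ed., OUP 1986,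
  Thm. 9.7, §2.1, §2.4, §2.12.
* [Hardy1914] G. H. Hardy, C. R. Acad. Sci. Paris 158 (1914) 1012–1014.
-/

noncomputable section

open Complex Filter Set Topology MeasureTheory Bornology Metric
open scoped Real FourierTransform ComplexConjugate

namespace Literature.NumberTheory.LFunctions

namespace BurnolEvaluatorCompleteness


/-! ## A. An entire quotient from meromorphic orders -/

/-- **Division in the ring of entire functions, by orders.** If `F` and `Z` are meromorphic on `ℂ`,
`Z` is nowhere locally zero, and `ord_s Z ≤ ord_s F` at every point, then there is an ENTIRE `θ` with
`θ = F/Z` at every point where `F/Z` is analytic (normal form of the meromorphic quotient). [folklore] -/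
private theorem exists_entire_of_meromorphicOrderAt_le {F Z : ℂ → ℂ} (hF : ∀ s, MeromorphicAt F s)
    (hZ : ∀ s, MeromorphicAt Z s) (hZtop : ∀ s, meromorphicOrderAt Z s ≠ ⊤)
    (hord : ∀ s, meromorphicOrderAt Z s ≤ meromorphicOrderAt F s) :
    ∃ θ : ℂ → ℂ, Differentiable ℂ θ ∧ (∀ s, θ =ᶠ[𝓝[≠] s] fun z ↦ F z / Z z) ∧
      ∀ s, AnalyticAt ℂ (fun z ↦ F z / Z z) s → θ s = F s / Z s := by
  set q : ℂ → ℂ := fun z ↦ F z / Z z with hq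
  have hqm : MeromorphicOn q univ := fun s _ ↦ (hF s).div (hZ s)
  have hqord : ∀ s, 0 ≤ meromorphicOrderAt q s := by
    intro s
    have h := meromorphicOrderAt_div (hF s) (hZ s)
    have h' : meromorphicOrderAt q s = meromorphicOrderAt F s - meromorphicOrderAt Z s := h
    rw [h']
    obtain ⟨m, hm⟩ := WithTop.ne_top_iff_exists.1 (hZtop s)
    rw [← hm]
    cases hFs : meromorphicOrderAt F s with
    | top => simp
    | coe n =>
      have hle : (m : WithTop ℤ) ≤ n := by rw [hm, ← hFs]; exact hord s
      have hle' : m ≤ n := WithTop.coe_le_coe.1 hle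
      rw [← WithTop.LinearOrderedAddCommGroup.coe_sub]
      exact WithTop.coe_nonneg.2 (by omega)
  set θ : ℂ → ℂ := toMeromorphicNFOn q univ with hθ
  have hNF : MeromorphicNFOn θ univ := meromorphicNFOn_toMeromorphicNFOn q univ
  have hθq : ∀ s, θ =ᶠ[𝓝[≠] s] q := fun s ↦ hqm.toMeromorphicNFOn_eq_self_on_nhdsNE (mem_univ s)
  have hdiv : 0 ≤ MeromorphicOn.divisor θ univ := by
    intro s
    simp only [Function.locallyFinsuppWithin.coe_zero, Pi.zero_apply]
    rw [MeromorphicOn.divisor_apply hNF.meromorphicOn (mem_univ s), WithTop.untop₀_nonneg,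
      meromorphicOrderAt_congr (hθq s)]
    exact hqord s
  have han : AnalyticOnNhd ℂ θ univ := hNF.divisor_nonneg_iff_analyticOnNhd.1 hdiv
  refine ⟨θ, fun s ↦ (han s (mem_univ s)).differentiableAt, hθq, fun s hs ↦ ?_⟩
  rw [hθ, toMeromorphicNFOn_eq_toMeromorphicNFAt hqm (mem_univ s),
    toMeromorphicNFAt_eq_self.2 hs.meromorphicNFAt]

/-! ## B. `ζ` as a meromorphic function on `ℂ`: orders -/

/-- `ζ` is not locally zero anywhere, and its meromorphic order at `s` is the tree's integer
multiplicity `m(s)` (`≥ 0` off `s = 1`, `−1` at the pole). [cite: Titchmarsh1986, §2.1 and §2.12] -/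
theorem meromorphicOrderAt_zeta_eq (s : ℂ) :
    meromorphicOrderAt riemannZeta s = (riemannZetaZeroOrder s : WithTop ℤ) := by
  have hne : meromorphicOrderAt riemannZeta s ≠ ⊤ := by
    by_cases hs : s = 1
    · subst hs
      intro htop
      have h := riemannZetaZeroOrder_one_holds
      rw [riemannZetaZeroOrder_one, riemannZetaZeroOrder, htop, WithTop.untop₀_top] at h
      norm_num at h
    · have ha : AnalyticAt ℂ riemannZeta s := analyticOn_riemannZeta s hs
      rw [ha.meromorphicOrderAt_eq]
      intro htop
      have htop' : analyticOrderAt riemannZeta s = ⊤ := by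
        cases h : analyticOrderAt riemannZeta s with
        | top => rfl
        | coe n => rw [h] at htop; exact absurd htop (by simp)
      have h2 : riemannZeta 2 = 0 :=
        analyticOn_riemannZeta.eqOn_zero_of_preconnected_of_eventuallyEq_zero
          (isConnected_compl_singleton_of_one_lt_rank (by simp) (1 : ℂ)).isPreconnected hs
          (analyticOrderAt_eq_top.mp htop') (show (2 : ℂ) ∈ ({1}ᶜ : Set ℂ) by norm_num)
      exact riemannZeta_ne_zero_of_one_le_re (s := 2) (by norm_num) h2
  rw [riemannZetaZeroOrder, WithTop.coe_untop₀_of_ne_top hne]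

/-- `ζ` is nowhere locally zero. [folklore] -/
private theorem meromorphicOrderAt_zeta_ne_top (s : ℂ) : meromorphicOrderAt riemannZeta s ≠ ⊤ := by
  rw [meromorphicOrderAt_zeta_eq]; exact WithTop.coe_ne_top

/-- `ζ` is meromorphic at every point of `ℂ` (holomorphic off the simple pole `s = 1`).
[cite: Titchmarsh1986, §2.1] -/
theorem meromorphicAt_zeta (s : ℂ) : MeromorphicAt riemannZeta s := by
  by_cases hs : s = 1
  · subst hs
    apply meromorphicAt_of_meromorphicOrderAt_ne_zero
    rw [meromorphicOrderAt_zeta_eq, show riemannZetaZeroOrder 1 = -1 from riemannZetaZeroOrder_one_holds]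
    decide
  · exact (analyticOn_riemannZeta s hs).meromorphicAt

/-- At a trivial zero the meromorphic order of `ζ` is `1`. [cite: Titchmarsh1986, §2.4] -/
theorem meromorphicOrderAt_zeta_trivialZero (k : ℕ) :
    meromorphicOrderAt riemannZeta (-2 * ((k : ℂ) + 1)) = 1 := by
  rw [meromorphicOrderAt_zeta_eq, riemannZetaZeroOrder_trivialZero k]
  rfl



/-! ## B. The continued transform `G_f`, `f ∈ L_a`, as a meromorphic function on `ℂ` -/

/-- `G_f` is analytic at every `s ≠ 1`. [cite: Burnol2004b, Prop. 2.2 (arXiv:math/0203120v7 p. 5)] -/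
theorem analyticAt_rightMellinExt {a : ℝ} (ha : 0 < a) {f : Lp ℂ 2 (volume : Measure ℝ)}
    (hf : f ∈ sonineL a) {s : ℂ} (hs : s ≠ 1) : AnalyticAt ℂ (rightMellinExt f) s :=
  (hasRightMellinContinuation_rightMellinExt_of_mem_sonineL ha hf).1.analyticAt
    (isOpen_ne.mem_nhds hs)

/-- `G_f` is meromorphic at `s = 1` with order `≥ −1` there (at most a simple pole: `(s−1)G_f(s)` has a
limit). [cite: Burnol2004b, Prop. 2.2 (arXiv:math/0203120v7 p. 5)] -/
theorem meromorphicAt_rightMellinExt_one {a : ℝ} (ha : 0 < a) {f : Lp ℂ 2 (volume : Measure ℝ)}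
    (hf : f ∈ sonineL a) :
    MeromorphicAt (rightMellinExt f) 1 ∧
      ((-1 : ℤ) : WithTop ℤ) ≤ meromorphicOrderAt (rightMellinExt f) 1 := by
  set G := rightMellinExt f with hGdef
  have hcont := hasRightMellinContinuation_rightMellinExt_of_mem_sonineL ha hf
  obtain ⟨⟨c, hc⟩, -⟩ := rightMellinExt_pole_and_zeros_of_mem_sonineL ha hf
  set g : ℂ → ℂ := Function.update (fun z : ℂ ↦ (z - 1) * G z) 1 c with hg
  have hga : AnalyticAt ℂ g 1 := by
    refine analyticAt_of_differentiable_on_punctured_nhds_of_continuousAt ?_ ?_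
    · filter_upwards [self_mem_nhdsWithin] with z hz
      have hz' : z ≠ 1 := hz
      have hev : g =ᶠ[𝓝 z] fun w : ℂ ↦ (w - 1) * G w := by
        filter_upwards [isOpen_ne.mem_nhds hz'] with w hw
        exact Function.update_of_ne hw _ _
      refine DifferentiableAt.congr_of_eventuallyEq ?_ hev
      exact ((differentiableAt_id.sub (differentiableAt_const _)).mul
        (hcont.1.differentiableAt (isOpen_ne.mem_nhds hz')))
    · exact continuousAt_update_same.2 hc
  have hgev : (fun z : ℂ ↦ (z - 1) * G z) =ᶠ[𝓝[≠] (1 : ℂ)] g := by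
    filter_upwards [self_mem_nhdsWithin] with z hz
    show (z - 1) * G z = g z
    rw [hg, Function.update_of_ne (show z ≠ 1 from hz)]
  have hev : ∀ᶠ z in 𝓝[≠] (1 : ℂ), G z = (z - 1) ^ (-1 : ℤ) • g z := by
    filter_upwards [self_mem_nhdsWithin] with z hz
    have hz' : z ≠ 1 := hz
    have hgz : g z = (z - 1) * G z := by simp [hg, Function.update_of_ne hz']
    rw [hgz, zpow_neg, zpow_one, smul_eq_mul, ← mul_assoc, inv_mul_cancel₀ (sub_ne_zero.2 hz'),
      one_mul]
  have hmero : MeromorphicAt G 1 := by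
    have h1 : MeromorphicAt (fun z : ℂ ↦ (z - 1) ^ (-1 : ℤ) • g z) 1 :=
      (((MeromorphicAt.id 1).sub (MeromorphicAt.const 1 1)).zpow (-1)).smul hga.meromorphicAt
    exact h1.congr (hev.mono fun z hz ↦ hz.symm)
  refine ⟨hmero, ?_⟩
  -- orders: `0 ≤ ord g = ord ((z-1)G) = 1 + ord G`
  have hlin : AnalyticAt ℂ (fun z : ℂ ↦ z - 1) 1 := analyticAt_id.sub analyticAt_const
  have hordlin : meromorphicOrderAt (fun z : ℂ ↦ z - 1) 1 = 1 := by
    rw [hlin.meromorphicOrderAt_eq]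
    have : analyticOrderAt (fun z : ℂ ↦ z - 1) 1 = 1 := by
      have h := analyticOrderAt_centeredMonomial (𝕜 := ℂ) (z₀ := (1 : ℂ)) (n := 1)
      simpa using h
    rw [this]; rfl
  have hprod : meromorphicOrderAt (fun z : ℂ ↦ (z - 1) * G z) 1 = 1 + meromorphicOrderAt G 1 := by
    rw [show (fun z : ℂ ↦ (z - 1) * G z) = (fun z : ℂ ↦ z - 1) * G from rfl,
      meromorphicOrderAt_mul hlin.meromorphicAt hmero, hordlin]
  have hnn : 0 ≤ meromorphicOrderAt (fun z : ℂ ↦ (z - 1) * G z) 1 := by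
    rw [meromorphicOrderAt_congr hgev]; exact hga.meromorphicOrderAt_nonneg
  rw [hprod] at hnn
  cases h : meromorphicOrderAt G 1 with
  | top => exact le_top
  | coe n =>
    rw [h] at hnn
    have : (0 : WithTop ℤ) ≤ ((1 + n : ℤ) : WithTop ℤ) := by exact_mod_cast hnn
    have h' := WithTop.coe_le_coe.1 this
    exact WithTop.coe_le_coe.2 (by omega)

/-- `G_f` is meromorphic at every point. [cite: Burnol2004b, Prop. 2.2 (arXiv:math/0203120v7 p. 5)] -/
theorem meromorphicAt_rightMellinExt {a : ℝ} (ha : 0 < a) {f : Lp ℂ 2 (volume : Measure ℝ)}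
    (hf : f ∈ sonineL a) (s : ℂ) : MeromorphicAt (rightMellinExt f) s := by
  by_cases hs : s = 1
  · subst hs; exact (meromorphicAt_rightMellinExt_one ha hf).1
  · exact (analyticAt_rightMellinExt ha hf hs).meromorphicAt

/-- From an analytic-order bound to a meromorphic-order bound. [folklore] -/
private theorem natCast_le_meromorphicOrderAt {g : ℂ → ℂ} {s : ℂ} (hg : AnalyticAt ℂ g s) {n : ℕ}
    (h : (n : ℕ∞) ≤ analyticOrderAt g s) : ((n : ℤ) : WithTop ℤ) ≤ meromorphicOrderAt g s := by
  rw [hg.meromorphicOrderAt_eq]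
  cases hk : analyticOrderAt g s with
  | top => exact le_top
  | coe k =>
    rw [hk] at h
    have hk' : n ≤ k := by exact_mod_cast h
    simp only [ENat.map_coe]
    exact_mod_cast hk'

/-! ## C. The polynomial weight `P_R(z) = ∏_{ρ ∈ R} (z − ρ)^{m(ρ)}` -/

/-- The weight `P_R(z) = ∏_{ρ∈R}(z−ρ)^{m(ρ)}` is entire. [folklore] -/
private theorem differentiable_weight (R : Finset ℂ) :
    Differentiable ℂ (fun z : ℂ ↦ ∏ ρ ∈ R, (z - ρ) ^ (riemannZetaZeroOrder ρ).toNat) :=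
  Differentiable.fun_finsetProd fun ρ _ ↦ (differentiable_id.sub_const ρ).pow _

/-- At `s ∈ R` the weight vanishes to order at least `m(s)`. [folklore] -/
private theorem le_meromorphicOrderAt_weight {R : Finset ℂ} {s : ℂ} (hs : s ∈ R) :
    (((riemannZetaZeroOrder s).toNat : ℤ) : WithTop ℤ) ≤
      meromorphicOrderAt (fun z : ℂ ↦ ∏ ρ ∈ R, (z - ρ) ^ (riemannZetaZeroOrder ρ).toNat) s := by
  set m : ℕ := (riemannZetaZeroOrder s).toNat with hm
  set Q : ℂ → ℂ := fun z ↦ ∏ ρ ∈ R.erase s, (z - ρ) ^ (riemannZetaZeroOrder ρ).toNat with hQ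
  have hPQ : (fun z : ℂ ↦ ∏ ρ ∈ R, (z - ρ) ^ (riemannZetaZeroOrder ρ).toNat) =
      fun z ↦ (z - s) ^ m * Q z := by
    funext z
    simp only [hQ]
    rw [Finset.mul_prod_erase R (fun ρ ↦ (z - ρ) ^ (riemannZetaZeroOrder ρ).toNat) hs]
  have hQd : Differentiable ℂ Q :=
    Differentiable.fun_finsetProd fun ρ _ ↦ (differentiable_id.sub_const ρ).pow _
  have hQa : AnalyticAt ℂ Q s := hQd.analyticAt s
  have hmon : AnalyticAt ℂ (fun z : ℂ ↦ (z - s) ^ m) s := (analyticAt_id.sub analyticAt_const).pow m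
  have hordmon : meromorphicOrderAt (fun z : ℂ ↦ (z - s) ^ m) s = (m : ℤ) := by
    rw [hmon.meromorphicOrderAt_eq]
    have h := analyticOrderAt_centeredMonomial (𝕜 := ℂ) (z₀ := s) (n := m)
    have h' : analyticOrderAt (fun z : ℂ ↦ (z - s) ^ m) s = m := h
    rw [h']; rfl
  rw [hPQ, show (fun z : ℂ ↦ (z - s) ^ m * Q z) = (fun z : ℂ ↦ (z - s) ^ m) * Q from rfl,
    meromorphicOrderAt_mul hmon.meromorphicAt hQa.meromorphicAt, hordmon]
  have hQ0 : 0 ≤ meromorphicOrderAt Q s := hQa.meromorphicOrderAt_nonneg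
  calc (((m : ℤ)) : WithTop ℤ) = (m : ℤ) + 0 := by simp
    _ ≤ ((m : ℤ) : WithTop ℤ) + meromorphicOrderAt Q s := by gcongr

/-- Norm bound for the weight: `‖P_R(z)‖ ≤ C_R (1 + ‖z‖)^{N_R}` with `C_R = ∏(1+|ρ|)^{m(ρ)} > 0`,
`N_R = Σ m(ρ)`. [folklore] -/
private theorem norm_weight_le (R : Finset ℂ) (z : ℂ) :
    ‖∏ ρ ∈ R, (z - ρ) ^ (riemannZetaZeroOrder ρ).toNat‖ ≤
      (∏ ρ ∈ R, (1 + ‖ρ‖) ^ (riemannZetaZeroOrder ρ).toNat) *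
        (1 + ‖z‖) ^ (∑ ρ ∈ R, (riemannZetaZeroOrder ρ).toNat) := by
  rw [norm_prod, Finset.prod_pow_eq_pow_sum .. |>.symm, ← Finset.prod_mul_distrib]
  refine Finset.prod_le_prod (fun _ _ ↦ norm_nonneg _) fun ρ _ ↦ ?_
  rw [norm_pow, ← mul_pow]
  refine pow_le_pow_left₀ (norm_nonneg _) ?_ _
  calc ‖z - ρ‖ ≤ ‖z‖ + ‖ρ‖ := norm_sub_le _ _
    _ ≤ (1 + ‖ρ‖) * (1 + ‖z‖) := by nlinarith [norm_nonneg z, norm_nonneg ρ]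

/-- The constant of the weight bound is positive. [folklore] -/
private theorem weightConst_pos (R : Finset ℂ) : 0 < ∏ ρ ∈ R, (1 + ‖ρ‖) ^ (riemannZetaZeroOrder ρ).toNat :=
  Finset.prod_pos fun ρ _ ↦ pow_pos (by positivity) _

/-- The weight does not vanish on `Re s ≥ 1` when `R` consists of non-trivial zeros. [folklore] -/
private theorem weight_ne_zero {R : Finset ℂ} (hR : ∀ ρ ∈ R, ρ ∈ ZetaZeros.riemannZetaNontrivialZeros)
    {s : ℂ} (hs : 1 ≤ s.re) : ∏ ρ ∈ R, (s - ρ) ^ (riemannZetaZeroOrder ρ).toNat ≠ 0 := by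
  refine Finset.prod_ne_zero_iff.2 fun ρ hρ ↦ pow_ne_zero _ (sub_ne_zero.2 fun h ↦ ?_)
  have := (mem_riemannZetaNontrivialZeros_iff_holds.1 (hR ρ hρ)).2.2
  rw [← h] at this; linarith

/-! ## D. The entire quotient `θ = G_f · P_R / ζ` -/

/-- **`θ := G_f·P_R/ζ` is entire** when `G_f` vanishes on the non-trivial zeros outside `R` to the
order of `ζ`: the orders match at every zero of `ζ` (non-trivial: hypothesis or the weight; trivial:
`G_f(−2n−2) = 0`, simple zeros of `ζ`) and at the pole `s = 1` (`G_f` has at most a simple pole).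
[cite: Burnol2004b, proof of Prop. 6.1 (arXiv:math/0203120v7 p. 15, TeX l.1210–1216)] -/
theorem exists_theta {a : ℝ} (ha : 0 < a) {f : Lp ℂ 2 (volume : Measure ℝ)} (hf : f ∈ sonineL a)
    {P : ℂ → ℂ} (hPa : ∀ s, AnalyticAt ℂ P s) (R : Finset ℂ)
    (hPR : ∀ ρ ∈ R, (((riemannZetaZeroOrder ρ).toNat : ℤ) : WithTop ℤ) ≤ meromorphicOrderAt P ρ)
    (hvan : ∀ ρ ∈ ZetaZeros.riemannZetaNontrivialZeros, ρ ∉ R →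
      (((riemannZetaZeroOrder ρ).toNat : ℕ) : ℕ∞) ≤ analyticOrderAt (rightMellinExt f) ρ) :
    ∃ θ : ℂ → ℂ, Differentiable ℂ θ ∧
      (∀ s, θ =ᶠ[𝓝[≠] s] fun z ↦ rightMellinExt f z * P z / riemannZeta z) ∧
      ∀ s, s ≠ 1 → riemannZeta s ≠ 0 →
        θ s = rightMellinExt f s * P s / riemannZeta s := by
  set G := rightMellinExt f with hGdef
  have hGm : ∀ s, MeromorphicAt G s := meromorphicAt_rightMellinExt ha hf
  have hF : ∀ s, MeromorphicAt (fun z ↦ G z * P z) s := fun s ↦ (hGm s).mul (hPa s).meromorphicAt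
  have hZtop : ∀ s, meromorphicOrderAt riemannZeta s ≠ ⊤ := fun s ↦ by
    rw [meromorphicOrderAt_zeta_eq]; exact WithTop.coe_ne_top
  have hzeros := (rightMellinExt_pole_and_zeros_of_mem_sonineL ha hf).2
  have hord : ∀ s, meromorphicOrderAt riemannZeta s ≤ meromorphicOrderAt (fun z ↦ G z * P z) s := by
    intro s
    rw [meromorphicOrderAt_zeta_eq, show (fun z ↦ G z * P z) = G * P from rfl,
      meromorphicOrderAt_mul (hGm s) (hPa s).meromorphicAt]
    have hP0 : 0 ≤ meromorphicOrderAt P s := (hPa s).meromorphicOrderAt_nonneg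
    by_cases h1 : s = 1
    · subst h1
      have hG1 := (meromorphicAt_rightMellinExt_one ha hf).2
      rw [show riemannZetaZeroOrder 1 = -1 from riemannZetaZeroOrder_one_holds]
      calc (((-1 : ℤ)) : WithTop ℤ) = ((-1 : ℤ) : WithTop ℤ) + 0 := by simp
        _ ≤ meromorphicOrderAt G 1 + meromorphicOrderAt P 1 := add_le_add hG1 hP0
    have hGa : AnalyticAt ℂ G s := analyticAt_rightMellinExt ha hf h1
    have hG0 : 0 ≤ meromorphicOrderAt G s := hGa.meromorphicOrderAt_nonneg
    by_cases hζ : riemannZeta s = 0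
    · by_cases hre : s.re ≤ 0
      · -- a trivial zero
        obtain ⟨k, hk⟩ := (riemannZeta_eq_zero_iff_of_re_nonpos hre).1 hζ
        have hk' : s = -2 * ((k : ℂ) + 1) := by rw [hk]
        have hm : riemannZetaZeroOrder s = 1 := by rw [hk']; exact riemannZetaZeroOrder_trivialZero k
        have hGs : G s = 0 := by rw [hk']; exact hzeros k
        have h1le : ((1 : ℕ) : ℕ∞) ≤ analyticOrderAt G s := by
          rw [Nat.cast_one, Order.one_le_iff_ne_zero]
          exact analyticOrderAt_ne_zero.2 ⟨hGa, hGs⟩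
        have hG1 := natCast_le_meromorphicOrderAt hGa h1le
        rw [hm]
        calc (((1 : ℤ)) : WithTop ℤ) = (((1 : ℕ) : ℤ) : WithTop ℤ) + 0 := by simp
          _ ≤ meromorphicOrderAt G s + meromorphicOrderAt P s := add_le_add hG1 hP0
      · -- a non-trivial zero
        have hre0 : 0 < s.re := lt_of_not_ge hre
        have hre1 : s.re < 1 := lt_of_not_ge fun h ↦ riemannZeta_ne_zero_of_one_le_re h hζ
        have hntz : s ∈ ZetaZeros.riemannZetaNontrivialZeros :=
          mem_riemannZetaNontrivialZeros_iff_holds.2 ⟨hζ, hre0, hre1⟩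
        have hm0 : 0 ≤ riemannZetaZeroOrder s := riemannZetaZeroOrder_nonneg h1
        have hmeq : (((riemannZetaZeroOrder s).toNat : ℕ) : ℤ) = riemannZetaZeroOrder s :=
          Int.toNat_of_nonneg hm0
        by_cases hsR : s ∈ R
        · have hPs := hPR s hsR
          rw [hmeq] at hPs
          calc ((riemannZetaZeroOrder s : ℤ) : WithTop ℤ) = 0 + (riemannZetaZeroOrder s : WithTop ℤ) := by
                simp
            _ ≤ meromorphicOrderAt G s + meromorphicOrderAt P s := add_le_add hG0 hPs
        · have hGs := natCast_le_meromorphicOrderAt hGa (hvan s hntz hsR)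
          rw [hmeq] at hGs
          calc ((riemannZetaZeroOrder s : ℤ) : WithTop ℤ) = (riemannZetaZeroOrder s : WithTop ℤ) + 0 := by
                simp
            _ ≤ meromorphicOrderAt G s + meromorphicOrderAt P s := add_le_add hGs hP0
    · -- not a zero, not the pole
      have hm : riemannZetaZeroOrder s = 0 :=
        le_antisymm (not_lt.1 fun h ↦ hζ ((riemannZetaZeroOrder_pos_iff h1).1 h))
          (riemannZetaZeroOrder_nonneg h1)
      rw [hm]
      simpa using add_nonneg hG0 hP0
  obtain ⟨θ, hθd, hθev, hθval⟩ := exists_entire_of_meromorphicOrderAt_le hF meromorphicAt_zeta hZtop hord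
  refine ⟨θ, hθd, ?_, fun s hs1 hsζ ↦ ?_⟩
  · intro s
    refine (hθev s).trans (Eventually.of_forall fun z ↦ ?_)
    simp only [mul_div_assoc]
  · have han : AnalyticAt ℂ (fun z ↦ G z * P z / riemannZeta z) s :=
      (((analyticAt_rightMellinExt ha hf hs1).mul (hPa s)).div (analyticOn_riemannZeta s hs1) hsζ)
    have h := hθval s han
    simpa [mul_div_assoc] using h

/-! ## E. Growth of `θ` -/

/-- `G_g` is bounded on `Re s ≥ 2` for `g ∈ L_a`, `a ≥ 1` (`|G_g(s)| ≤ |c|a^{1−σ}/|1−s| + (‖g‖² + a^{1−2σ}/(2σ−1))/2`).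
[cite: Burnol2004b, proof of Thm. 4.8 (arXiv:math/0203120v7 p. 10)] -/
theorem exists_bound_rightMellinExt_two_le {a : ℝ} (ha1 : 1 ≤ a) {g : Lp ℂ 2 (volume : Measure ℝ)}
    (hg : g ∈ sonineL a) :
    ∃ C : ℝ, 0 ≤ C ∧ ∀ s : ℂ, 2 ≤ s.re → ‖rightMellinExt g s‖ ≤ C := by
  have ha : 0 < a := by linarith
  obtain ⟨c, hgc⟩ := hg.2.1
  have hex : ∃ G, HasRightMellinContinuation g G :=
    ⟨_, hasRightMellinContinuation_rightMellinExt_of_mem_sonineL ha hg⟩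
  refine ⟨‖c‖ + ((∫ x, ‖(g : ℝ → ℂ) x‖ ^ 2) + 1) / 2, by positivity, fun s hs ↦ ?_⟩
  have hs1 : s ≠ 1 := by intro h; rw [h, one_re] at hs; norm_num at hs
  have h := BurnolLProperty.norm_rightMellinExt_le_of_re_gt_half ha hgc hex (s := s) (by linarith) hs1
  refine h.trans (add_le_add ?_ ?_)
  · have h1 : 1 ≤ ‖1 - s‖ := by
      calc (1 : ℝ) ≤ |(1 - s).re| := by
            rw [sub_re, one_re, abs_of_nonpos (by linarith)]; linarith
        _ ≤ ‖1 - s‖ := abs_re_le_norm _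
    have h2 : a ^ (1 - s.re) ≤ 1 := Real.rpow_le_one_of_one_le_of_nonpos ha1 (by linarith)
    calc ‖c‖ * a ^ (1 - s.re) / ‖1 - s‖ ≤ ‖c‖ * 1 / 1 := by
          gcongr
      _ = ‖c‖ := by ring
  · have h2 : a ^ (1 - 2 * s.re) ≤ 1 := Real.rpow_le_one_of_one_le_of_nonpos ha1 (by linarith)
    have h3 : a ^ (1 - 2 * s.re) / (2 * s.re - 1) ≤ 1 := by
      rw [div_le_one (by linarith)]; linarith
    gcongr

/-- `‖1/ζ(s)‖ ≤ C_ζ := Σ k^{−2}` on `Re s ≥ 2`, with `C_ζ ≥ 0`. [folklore] -/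
private theorem exists_bound_inv_zeta_two_le :
    ∃ C : ℝ, 0 ≤ C ∧ ∀ s : ℂ, 2 ≤ s.re → ‖(riemannZeta s)⁻¹‖ ≤ C :=
  ⟨∑' k : ℕ, (k : ℝ) ^ (-(2 : ℝ)), tsum_nonneg fun k ↦ Real.rpow_nonneg k.cast_nonneg _,
    fun _ hs ↦ BurnolResidueSum.norm_inv_zeta_le_of_two_le_re hs⟩

section Theta

variable {a : ℝ} {f : Lp ℂ 2 (volume : Measure ℝ)} {P : ℂ → ℂ} {CP : ℝ} {N : ℕ} {θ : ℂ → ℂ}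

/-- **Right half-plane**: `‖θ(s)‖ ≤ C (1+‖s‖)^{N_R}` on `Re s ≥ 2`.
[cite: Burnol2004b, proof of Prop. 6.1 ("`G(s)/ζ(s)` is `O(A^{Re s})` in `Re s ≥ 2`", arXiv:math/0203120v7 p. 15, TeX l.1228–1230)] -/
theorem exists_bound_theta_right (ha1 : 1 ≤ a) (hf : f ∈ sonineL a)
    (hCP : 0 ≤ CP) (hPn : ∀ z : ℂ, ‖P z‖ ≤ CP * (1 + ‖z‖) ^ N)
    (hθ : ∀ s, s ≠ 1 → riemannZeta s ≠ 0 →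
      θ s = rightMellinExt f s * P s / riemannZeta s) :
    ∃ C : ℝ, 0 ≤ C ∧ ∀ s : ℂ, 2 ≤ s.re → ‖θ s‖ ≤ C * (1 + ‖s‖) ^ N := by
  obtain ⟨CG, hCG0, hCG⟩ := exists_bound_rightMellinExt_two_le ha1 hf
  obtain ⟨Cζ, hCζ0, hCζ⟩ := exists_bound_inv_zeta_two_le
  refine ⟨CG * CP * Cζ, by positivity, fun s hs ↦ ?_⟩
  have hs1 : s ≠ 1 := by intro h; rw [h, one_re] at hs; norm_num at hs
  have hζ : riemannZeta s ≠ 0 := riemannZeta_ne_zero_of_one_le_re (by linarith)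
  rw [hθ s hs1 hζ, div_eq_mul_inv, norm_mul, norm_mul]
  have hP := hPn s
  calc ‖rightMellinExt f s‖ * ‖P s‖ * ‖(riemannZeta s)⁻¹‖
      ≤ CG * (CP * (1 + ‖s‖) ^ N) * Cζ := by
        refine mul_le_mul (mul_le_mul (hCG s hs) hP (norm_nonneg _) hCG0) (hCζ s hs)
          (norm_nonneg _) (by positivity)
    _ = CG * CP * Cζ * (1 + ‖s‖) ^ N := by ring

/-- **Left half-plane, off the trivial zeros**: on `Re s ≤ −1`, `ζ(s) ≠ 0`, both functional equations
give `θ(s) = G_{𝓕f}(1−s)P_R(s)/ζ(1−s)`, hence `‖θ(s)‖ ≤ C(1+‖s‖)^{N_R}`.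
[cite: Burnol2004b, proof of Prop. 6.1 ("from the functional equation … `θ(1−s) = 𝓕₊(g)^(s)/ζ(s)`", arXiv:math/0203120v7 p. 15, TeX l.1217–1222)] -/
theorem exists_bound_theta_left_of_ne (ha1 : 1 ≤ a) (hf : f ∈ sonineL a)
    (hCP : 0 ≤ CP) (hPn : ∀ z : ℂ, ‖P z‖ ≤ CP * (1 + ‖z‖) ^ N)
    (hθ : ∀ s, s ≠ 1 → riemannZeta s ≠ 0 →
      θ s = rightMellinExt f s * P s / riemannZeta s) :
    ∃ C : ℝ, 0 ≤ C ∧ ∀ s : ℂ, s.re ≤ -1 → riemannZeta s ≠ 0 →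
      ‖θ s‖ ≤ C * (1 + ‖s‖) ^ N := by
  have ha : 0 < a := by linarith
  have hFf : (𝓕 f : Lp ℂ 2 (volume : Measure ℝ)) ∈ sonineL a := fourier_mem_sonineL hf
  obtain ⟨CG, hCG0, hCG⟩ := exists_bound_rightMellinExt_two_le ha1 hFf
  obtain ⟨Cζ, hCζ0, hCζ⟩ := exists_bound_inv_zeta_two_le
  refine ⟨CG * CP * Cζ, by positivity, fun s hs hζ ↦ ?_⟩
  have hs1 : s ≠ 1 := by intro h; rw [h, one_re] at hs; norm_num at hs
  have hs0 : s ≠ 0 := by intro h; rw [h, zero_re] at hs; norm_num at hs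
  have h1s : 2 ≤ (1 - s).re := by rw [sub_re, one_re]; linarith
  have h1s0 : 1 - s ≠ 0 := by intro h; rw [h, zero_re] at h1s; norm_num at h1s
  -- `s` is not a pole of `Γ_ℝ` (else it would be `0` or a trivial zero) and not in `1 + 2ℕ`
  have hsn : ∀ n : ℕ, s ≠ -2 * (n : ℂ) := by
    intro n hn
    rcases n with _ | k
    · exact hs0 (by simpa using hn)
    · apply hζ
      rw [hn]
      have : (-2 : ℂ) * ((k + 1 : ℕ) : ℂ) = -2 * ((k : ℂ) + 1) := by push_cast; ring
      rw [this]
      exact riemannZeta_neg_two_mul_nat_add_one k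
  have hsn' : ∀ n : ℕ, s ≠ 1 + 2 * (n : ℂ) := by
    intro n hn
    have := congrArg Complex.re hn
    simp at this
    linarith [n.cast_nonneg (α := ℝ)]
  have hΓs : Gammaℝ s ≠ 0 := by
    rw [Ne, Gammaℝ_eq_zero_iff]
    rintro ⟨n, hn⟩
    exact hsn n (by rw [hn]; ring)
  have hΓ1s : Gammaℝ (1 - s) ≠ 0 := Gammaℝ_ne_zero_of_re_pos (by linarith)
  have hζ1s : riemannZeta (1 - s) ≠ 0 := riemannZeta_ne_zero_of_one_le_re (by linarith)
  -- the two functional equations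
  have hG : rightMellinExt f s = Gammaℝ (1 - s) / Gammaℝ s *
      rightMellinExt (𝓕 f : Lp ℂ 2 (volume : Measure ℝ)) (1 - s) :=
    BurnolLProperty.rightMellinExt_eq_chi_mul ha hf hsn hsn'
  have hZ : riemannZeta s = Gammaℝ (1 - s) / Gammaℝ s * riemannZeta (1 - s) := by
    rw [riemannZeta_def_of_ne_zero hs0, riemannZeta_def_of_ne_zero h1s0,
      completedRiemannZeta_one_sub]
    field_simp
  have hθs : θ s = rightMellinExt (𝓕 f : Lp ℂ 2 (volume : Measure ℝ)) (1 - s) * P s /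
      riemannZeta (1 - s) := by
    rw [hθ s hs1 hζ, hG, hZ]
    field_simp
  rw [hθs, div_eq_mul_inv, norm_mul, norm_mul]
  have hP := hPn s
  calc ‖rightMellinExt (𝓕 f : Lp ℂ 2 (volume : Measure ℝ)) (1 - s)‖ * ‖P s‖ *
        ‖(riemannZeta (1 - s))⁻¹‖
      ≤ CG * (CP * (1 + ‖s‖) ^ N) * Cζ := by
        refine mul_le_mul (mul_le_mul (hCG _ h1s) hP (norm_nonneg _) hCG0) (hCζ _ h1s)
          (norm_nonneg _) (by positivity)
    _ = CG * CP * Cζ * (1 + ‖s‖) ^ N := by ring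

/-- **Left half-plane, everywhere** (the trivial zeros by continuity along the vertical direction, on
which `ζ ≠ 0`). [cite: Burnol2004b, proof of Prop. 6.1 (arXiv:math/0203120v7 p. 15, TeX l.1217–1222)] -/
theorem exists_bound_theta_left (ha1 : 1 ≤ a) (hf : f ∈ sonineL a) (hθd : Differentiable ℂ θ)
    (hCP : 0 ≤ CP) (hPn : ∀ z : ℂ, ‖P z‖ ≤ CP * (1 + ‖z‖) ^ N)
    (hθ : ∀ s, s ≠ 1 → riemannZeta s ≠ 0 →
      θ s = rightMellinExt f s * P s / riemannZeta s) :
    ∃ C : ℝ, 0 ≤ C ∧ ∀ s : ℂ, s.re ≤ -1 → ‖θ s‖ ≤ C * (1 + ‖s‖) ^ N := by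
  obtain ⟨C, hC0, hC⟩ := exists_bound_theta_left_of_ne ha1 hf hCP hPn hθ
  refine ⟨C, hC0, fun s hs ↦ ?_⟩
  by_cases hζ : riemannZeta s = 0
  swap
  · exact hC s hs hζ
  -- `s` is a (real) trivial zero; approach it vertically
  set ε : ℕ → ℝ := fun n ↦ 1 / ((n : ℝ) + 1) with hε
  have hεpos : ∀ n, 0 < ε n := fun n ↦ by rw [hε]; positivity
  set u : ℕ → ℂ := fun n ↦ s + (ε n : ℂ) * I with hu
  have hure : ∀ n, (u n).re = s.re := fun n ↦ by simp [hu]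
  have huim : ∀ n, (u n).im = s.im + ε n := fun n ↦ by simp [hu]
  have hsim : s.im = 0 := by
    obtain ⟨k, hk⟩ := (riemannZeta_eq_zero_iff_of_re_nonpos (by linarith : s.re ≤ 0)).1 hζ
    rw [hk]; simp
  have hune : ∀ n, riemannZeta (u n) ≠ 0 := by
    intro n h0
    obtain ⟨m, hm⟩ := (riemannZeta_eq_zero_iff_of_re_nonpos (by rw [hure]; linarith)).1 h0
    have h1 := congrArg Complex.im hm
    rw [huim, hsim] at h1
    simp at h1
    linarith [hεpos n]
  have hlim : Tendsto u atTop (𝓝 s) := by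
    have h1 : Tendsto ε atTop (𝓝 0) := tendsto_one_div_add_atTop_nhds_zero_nat
    have h2 : Tendsto (fun n : ℕ ↦ s + ((ε n : ℝ) : ℂ) * I) atTop (𝓝 (s + ((0 : ℝ) : ℂ) * I)) :=
      tendsto_const_nhds.add (((continuous_ofReal.tendsto 0).comp h1).mul tendsto_const_nhds)
    simpa [hu] using h2
  have hleft : Tendsto (fun n ↦ ‖θ (u n)‖) atTop (𝓝 ‖θ s‖) :=
    (continuous_norm.tendsto _).comp ((hθd.continuous.tendsto s).comp hlim)
  have hright : Tendsto (fun n ↦ C * (1 + ‖u n‖) ^ N) atTop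
      (𝓝 (C * (1 + ‖s‖) ^ N)) := by
    have hc : Continuous fun z : ℂ ↦ C * (1 + ‖z‖) ^ N := by fun_prop
    exact (hc.tendsto s).comp hlim
  exact le_of_tendsto_of_tendsto' hleft hright fun n ↦ hC (u n) (by rw [hure]; exact hs) (hune n)

end Theta

/-- **No zero of `ζ` on a good horizontal segment.** If `‖1/ζ‖ ≤ B` on the segment `σ ∈ [−1,2]` at a
height `T ≠ 0` (read with Lean's `0⁻¹ = 0`, so a priori vacuous AT a zero), then `ζ ≠ 0` there: next
to a zero on the segment `‖1/ζ‖` is unbounded (zeros are isolated). [cite: Titchmarsh1986, Thm. 9.7] -/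
theorem zeta_ne_zero_of_norm_inv_le {T B : ℝ} (hT : T ≠ 0)
    (h : ∀ σ ∈ Icc (-1 : ℝ) 2, ‖(riemannZeta (σ + T * I))⁻¹‖ ≤ B) :
    ∀ σ ∈ Icc (-1 : ℝ) 2, riemannZeta (σ + T * I) ≠ 0 := by
  intro σ hσ h0
  set s₀ : ℂ := σ + T * I with hs₀
  have him : s₀.im = T := by simp [hs₀]
  have hre : s₀.re = σ := by simp [hs₀]
  obtain ⟨h0re, h1re⟩ := re_mem_Ioo_of_riemannZeta_eq_zero_of_im_ne_zero h0 (by rw [him]; exact hT)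
  rw [hre] at h0re h1re
  have hs1 : s₀ ≠ 1 := by
    intro h1; have := congrArg Complex.im h1; rw [him] at this; simp at this; exact hT this
  have han : AnalyticAt ℂ riemannZeta s₀ := analyticOn_riemannZeta s₀ hs1
  -- the zero is isolated
  have hiso : ∀ᶠ z in 𝓝[≠] s₀, riemannZeta z ≠ 0 := by
    rcases han.eventually_eq_zero_or_eventually_ne_zero with h' | h'
    · exfalso
      exact meromorphicOrderAt_zeta_ne_top s₀
        (meromorphicOrderAt_eq_top_iff.2 (h'.filter_mono nhdsWithin_le_nhds))
    · exact h'
  -- `ζ → 0` at `s₀`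
  have hB0 : 0 ≤ B := (norm_nonneg _).trans (h σ hσ)
  have hsmall : ∀ᶠ z in 𝓝 s₀, ‖riemannZeta z‖ < (B + 1)⁻¹ := by
    have hc : Tendsto (fun z ↦ ‖riemannZeta z‖) (𝓝 s₀) (𝓝 0) := by
      have h' := (continuous_norm.tendsto _).comp han.continuousAt
      rwa [Function.comp_def, h0, norm_zero] at h'
    exact hc.eventually (gt_mem_nhds (by positivity))
  -- the horizontal approach `u ↦ s₀ + u`
  have hpath : Tendsto (fun u : ℝ ↦ s₀ + (u : ℂ)) (𝓝[≠] 0) (𝓝[≠] s₀) := by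
    refine tendsto_nhdsWithin_of_tendsto_nhds_of_eventually_within _ ?_ ?_
    · have h' : Tendsto (fun u : ℝ ↦ s₀ + (u : ℂ)) (𝓝 0) (𝓝 (s₀ + ((0 : ℝ) : ℂ))) :=
        tendsto_const_nhds.add (continuous_ofReal.tendsto 0)
      rw [ofReal_zero, add_zero] at h'
      exact h'.mono_left nhdsWithin_le_nhds
    · filter_upwards [self_mem_nhdsWithin] with u hu
      simp only [mem_compl_iff, mem_singleton_iff, add_eq_left, ofReal_eq_zero]
      exact hu
  have hnear : ∀ᶠ u : ℝ in 𝓝[≠] 0, |u| < 1 := by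
    have h' : Tendsto (fun u : ℝ ↦ |u|) (𝓝 0) (𝓝 0) := by
      simpa using (continuous_abs.tendsto (0 : ℝ))
    exact (h'.eventually (gt_mem_nhds zero_lt_one)).filter_mono nhdsWithin_le_nhds
  obtain ⟨u, ⟨hu1, hu2⟩, hu3⟩ :=
    (((hpath.eventually hiso).and ((hpath.mono_right nhdsWithin_le_nhds).eventually hsmall)).and
      hnear).exists
  have hmem : σ + u ∈ Icc (-1 : ℝ) 2 := by
    constructor <;> linarith [(abs_lt.1 hu3).1, (abs_lt.1 hu3).2]
  have hb := h (σ + u) hmem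
  have heq : ((σ + u : ℝ) : ℂ) + T * I = s₀ + u := by rw [hs₀]; push_cast; ring
  rw [heq, norm_inv] at hb
  have hpos : 0 < ‖riemannZeta (s₀ + u)‖ := norm_pos_iff.2 hu1
  have hB1 : 0 < B + 1 := by linarith
  have : B + 1 < ‖riemannZeta (s₀ + u)‖⁻¹ := (lt_inv_comm₀ hpos hB1).1 hu2
  linarith

/-- **Maximum modulus on a rectangle**: a bound for an entire `θ` on the four edges of
`[x₁,x₂] × [y₁,y₂]` bounds it inside. [folklore] -/
private theorem norm_le_of_rect {θ : ℂ → ℂ} (hθd : Differentiable ℂ θ) {x₁ x₂ y₁ y₂ B : ℝ}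
    (hx : x₁ < x₂) (hy : y₁ < y₂)
    (hh : ∀ z : ℂ, z.re ∈ Icc x₁ x₂ → (z.im = y₁ ∨ z.im = y₂) → ‖θ z‖ ≤ B)
    (hv : ∀ z : ℂ, (z.re = x₁ ∨ z.re = x₂) → z.im ∈ Icc y₁ y₂ → ‖θ z‖ ≤ B)
    {z : ℂ} (hzre : z.re ∈ Icc x₁ x₂) (hzim : z.im ∈ Icc y₁ y₂) : ‖θ z‖ ≤ B := by
  set U : Set ℂ := Ioo x₁ x₂ ×ℂ Ioo y₁ y₂ with hU
  have hUb : IsBounded U := (isBounded_Ioo x₁ x₂).reProdIm (isBounded_Ioo y₁ y₂)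
  have hcl : z ∈ closure U := by
    rw [hU, closure_reProdIm, closure_Ioo hx.ne, closure_Ioo hy.ne]
    exact ⟨hzre, hzim⟩
  refine Complex.norm_le_of_forall_mem_frontier_norm_le hUb hθd.diffContOnCl (fun w hw ↦ ?_) hcl
  rw [hU, frontier_reProdIm, closure_Ioo hx.ne, closure_Ioo hy.ne, frontier_Ioo hx, frontier_Ioo hy]
    at hw
  rcases hw with ⟨h1, h2⟩ | ⟨h1, h2⟩
  · refine hh w h1 ?_
    simpa [mem_insert_iff, mem_singleton_iff] using h2
  · refine hv w ?_ h2
    simpa [mem_insert_iff, mem_singleton_iff] using h1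

section Strip

variable {a : ℝ} {f : Lp ℂ 2 (volume : Measure ℝ)} {P : ℂ → ℂ} {CP : ℝ} {N : ℕ} {θ : ℂ → ℂ}

/-- `(1+x)`-powers are monotone in the exponent for `x ≥ 0`. [folklore] -/
private theorem pow_mono_exp {x : ℝ} (hx : 0 ≤ x) {m n : ℕ} (h : m ≤ n) :
    (1 + x) ^ m ≤ (1 + x) ^ n :=
  pow_le_pow_right₀ (by linarith) h

/-- **A priori polynomial bound in the strip `−1 ≤ Re s ≤ 2`**: between two consecutive good heights of
Titchmarsh's Theorem 9.7 (`|1/ζ| ≤ T^A` on the horizontal segments, one in every unit interval) the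
entire `θ` is bounded by its maximum on the boundary of the rectangle, where `G_f` is polynomial (the
L-Property, Thm. 4.8), `P_R` is polynomial and `1/ζ` is polynomial (good heights) or bounded (vertical
edges). [cite: Titchmarsh1986, Thm. 9.7; Burnol2004b, Thm. 4.8 (arXiv:math/0203120v7 p. 9)] -/
theorem exists_bound_theta_strip (ha : 0 < a) (hf : f ∈ sonineL a) (hθd : Differentiable ℂ θ)
    (hCP : 0 ≤ CP) (hPn : ∀ z : ℂ, ‖P z‖ ≤ CP * (1 + ‖z‖) ^ N)
    (hθ : ∀ s, s ≠ 1 → riemannZeta s ≠ 0 →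
      θ s = rightMellinExt f s * P s / riemannZeta s)
    {C₁ : ℝ} (hC₁0 : 0 ≤ C₁) (hC₁ : ∀ s : ℂ, 2 ≤ s.re → ‖θ s‖ ≤ C₁ * (1 + ‖s‖) ^ N)
    {C₂ : ℝ} (hC₂0 : 0 ≤ C₂)
    (hC₂ : ∀ s : ℂ, s.re ≤ -1 → riemannZeta s ≠ 0 → ‖θ s‖ ≤ C₂ * (1 + ‖s‖) ^ N) :
    ∃ C : ℝ, 0 ≤ C ∧ ∃ M : ℕ, N ≤ M ∧
      ∀ s : ℂ, -1 ≤ s.re → s.re ≤ 2 → ‖θ s‖ ≤ C * (1 + ‖s‖) ^ M := by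
  set G := rightMellinExt f with hGdef
  -- Titchmarsh 9.7 and the L-Property
  obtain ⟨A, hA0, T₀, hT₀8, hgood⟩ := InvZetaPoly.exists_norm_inv_zeta_le_rpow
  obtain ⟨CL, T₁, hL⟩ := Burnol2004b_thm4_8_holds a ha f hf (-1) 2 1 (by norm_num) one_pos
  have hexp : max (1 / 2 - (-1 : ℝ)) 0 + 1 = 5 / 2 := by norm_num
  set K : ℕ := ⌈A⌉₊ with hK
  have hAK : A ≤ K := Nat.le_ceil A
  set M : ℕ := N + K + 3 with hM
  set CL' : ℝ := max CL 0 with hCL'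
  -- the horizontal bound at a good height
  set Ch : ℝ := CL' * (CP * 3 ^ N) with hCh
  have hCh0 : 0 ≤ Ch := by positivity
  have horiz : ∀ T : ℝ, max T₀ |T₁| ≤ T →
      (∀ σ ∈ Icc (-1 : ℝ) 2, ‖(riemannZeta (σ + T * I))⁻¹‖ ≤ T ^ A ∧
        ‖(riemannZeta (σ - T * I))⁻¹‖ ≤ T ^ A) →
      ∀ z : ℂ, z.re ∈ Icc (-1 : ℝ) 2 → |z.im| = T → ‖θ z‖ ≤ Ch * (1 + T) ^ M := by
    intro T hT hb z hzre hzim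
    have hT8 : 8 ≤ T := hT₀8.trans ((le_max_left _ _).trans hT)
    have hT0 : 0 < T := by linarith
    have hT1 : T₁ ≤ |z.im| := by rw [hzim]; exact (le_abs_self _).trans ((le_max_right _ _).trans hT)
    -- `ζ z ≠ 0` and `‖1/ζ z‖ ≤ T^A`
    have hplus : ∀ σ ∈ Icc (-1 : ℝ) 2, ‖(riemannZeta (σ + T * I))⁻¹‖ ≤ T ^ A := fun σ hσ ↦ (hb σ hσ).1
    have hminus : ∀ σ ∈ Icc (-1 : ℝ) 2, ‖(riemannZeta (σ + ((-T : ℝ) : ℂ) * I))⁻¹‖ ≤ T ^ A := by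
      intro σ hσ
      have e : (σ : ℂ) + ((-T : ℝ) : ℂ) * I = σ - T * I := by push_cast; ring
      rw [e]; exact (hb σ hσ).2
    have hz : z = (z.re : ℂ) + (z.im : ℂ) * I := (re_add_im z).symm
    have hζinv : riemannZeta z ≠ 0 ∧ ‖(riemannZeta z)⁻¹‖ ≤ T ^ A := by
      rcases (abs_eq hT0.le).1 hzim with h | h
      · rw [hz, h]
        exact ⟨zeta_ne_zero_of_norm_inv_le hT0.ne' hplus z.re hzre, hplus z.re hzre⟩
      · rw [hz, h]
        exact ⟨zeta_ne_zero_of_norm_inv_le (neg_ne_zero.2 hT0.ne') hminus z.re hzre,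
          hminus z.re hzre⟩
    have hz1 : z ≠ 1 := by
      intro h1; rw [h1, one_im, abs_zero] at hzim; linarith
    -- the three factors
    have hGz : ‖G z‖ ≤ CL' * (1 + T) ^ 3 := by
      have h1 := hL z.re z.im hzre.1 hzre.2 hT1
      rw [← hz, hexp, hzim] at h1
      refine h1.trans ?_
      have h1T : 1 ≤ 1 + T := by linarith
      calc CL * (1 + T) ^ (5 / 2 : ℝ) ≤ CL' * (1 + T) ^ (5 / 2 : ℝ) :=
            mul_le_mul_of_nonneg_right (le_max_left _ _) (by positivity)
        _ ≤ CL' * (1 + T) ^ ((3 : ℕ) : ℝ) :=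
            mul_le_mul_of_nonneg_left (Real.rpow_le_rpow_of_exponent_le h1T (by norm_num))
              (le_max_right _ _)
        _ = CL' * (1 + T) ^ 3 := by rw [Real.rpow_natCast]
    have hnz : ‖z‖ ≤ 2 + T := by
      calc ‖z‖ ≤ |z.re| + |z.im| := norm_le_abs_re_add_abs_im z
        _ ≤ 2 + T := by
          rw [hzim]; have := abs_le.2 (And.intro (by linarith [hzre.1]) hzre.2); linarith
    have hPz : ‖P z‖ ≤ CP * 3 ^ N * (1 + T) ^ N := by
      refine (hPn z).trans ?_
      rw [mul_assoc, ← mul_pow]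
      refine mul_le_mul_of_nonneg_left (pow_le_pow_left₀ (by positivity) (by linarith) N) hCP
    have hζz : ‖(riemannZeta z)⁻¹‖ ≤ (1 + T) ^ K := by
      refine hζinv.2.trans ?_
      calc T ^ A ≤ (1 + T) ^ A := Real.rpow_le_rpow hT0.le (by linarith) hA0.le
        _ ≤ (1 + T) ^ (K : ℝ) := Real.rpow_le_rpow_of_exponent_le (by linarith) hAK
        _ = (1 + T) ^ K := Real.rpow_natCast _ _
    rw [hθ z hz1 hζinv.1, div_eq_mul_inv, norm_mul, norm_mul]
    calc ‖G z‖ * ‖P z‖ * ‖(riemannZeta z)⁻¹‖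
        ≤ CL' * (1 + T) ^ 3 * (CP * 3 ^ N * (1 + T) ^ N) * (1 + T) ^ K := by
          refine mul_le_mul (mul_le_mul hGz hPz (norm_nonneg _) (by positivity)) hζz
            (norm_nonneg _) (by positivity)
      _ = Ch * (1 + T) ^ M := by rw [hCh, hM]; ring
  -- the vertical edges
  set Cv : ℝ := (C₁ + C₂) * 3 ^ N with hCv
  have vert : ∀ z : ℂ, (z.re = -1 ∨ z.re = 2) → ∀ T : ℝ, 0 ≤ T → |z.im| ≤ T →
      ‖θ z‖ ≤ Cv * (1 + T) ^ M := by
    intro z hzre T hT0 hzT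
    have hnz : 1 + ‖z‖ ≤ 3 * (1 + T) := by
      calc 1 + ‖z‖ ≤ 1 + (|z.re| + |z.im|) := by linarith [norm_le_abs_re_add_abs_im z]
        _ ≤ 3 * (1 + T) := by
          rcases hzre with h | h <;> rw [h] <;> norm_num <;> linarith
    have hpow : (1 + ‖z‖) ^ N ≤ 3 ^ N * (1 + T) ^ M := by
      calc (1 + ‖z‖) ^ N ≤ (3 * (1 + T)) ^ N := pow_le_pow_left₀ (by positivity) hnz N
        _ = 3 ^ N * (1 + T) ^ N := mul_pow _ _ _
        _ ≤ 3 ^ N * (1 + T) ^ M :=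
          mul_le_mul_of_nonneg_left (pow_mono_exp hT0 (by rw [hM]; omega)) (by positivity)
    rcases hzre with h | h
    · have hζ : riemannZeta z ≠ 0 := by
        intro h0
        obtain ⟨n, hn⟩ := (riemannZeta_eq_zero_iff_of_re_nonpos (by rw [h]; norm_num)).1 h0
        have := congrArg Complex.re hn
        rw [h] at this; simp at this
        have h2 : (n : ℝ) = -1 / 2 := by linarith
        have h3 : (0 : ℝ) ≤ n := n.cast_nonneg
        linarith
      calc ‖θ z‖ ≤ C₂ * (1 + ‖z‖) ^ N := hC₂ z (by rw [h]) hζ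
        _ ≤ (C₁ + C₂) * (1 + ‖z‖) ^ N := by gcongr; linarith
        _ ≤ (C₁ + C₂) * (3 ^ N * (1 + T) ^ M) := mul_le_mul_of_nonneg_left hpow (by positivity)
        _ = Cv * (1 + T) ^ M := by rw [hCv]; ring
    · calc ‖θ z‖ ≤ C₁ * (1 + ‖z‖) ^ N := hC₁ z (by rw [h])
        _ ≤ (C₁ + C₂) * (1 + ‖z‖) ^ N := by gcongr; linarith
        _ ≤ (C₁ + C₂) * (3 ^ N * (1 + T) ^ M) := mul_le_mul_of_nonneg_left hpow (by positivity)
        _ = Cv * (1 + T) ^ M := by rw [hCv]; ring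
  -- far from the real axis: rectangles between good heights
  set Tstar : ℝ := max T₀ |T₁| + 2 with hTstar
  set Cfar : ℝ := (Ch + Cv) * 3 ^ M with hCfar
  have far : ∀ s : ℂ, -1 ≤ s.re → s.re ≤ 2 → Tstar ≤ |s.im| →
      ‖θ s‖ ≤ Cfar * (1 + ‖s‖) ^ M := by
    intro s hs1 hs2 hst
    set t : ℝ := |s.im| with ht
    have ht0 : 0 ≤ t := abs_nonneg _
    -- good heights just below and just above `t`
    obtain ⟨Tlo, hTloI, hTlo⟩ := hgood (t - 2) (by
      have := le_max_left T₀ |T₁|; rw [hTstar] at hst; linarith)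
    obtain ⟨Thi, hThiI, hThi⟩ := hgood (t + 1) (by
      have := le_max_left T₀ |T₁|; rw [hTstar] at hst; linarith)
    have hlo1 : Tlo ≤ t - 1 := by have := hTloI.2; linarith
    have hlo2 : t - 2 ≤ Tlo := hTloI.1
    have hhi1 : t + 1 ≤ Thi := hThiI.1
    have hhi2 : Thi ≤ t + 2 := by have := hThiI.2; linarith
    have hloM : max T₀ |T₁| ≤ Tlo := by rw [hTstar] at hst; linarith
    have hhiM : max T₀ |T₁| ≤ Thi := by rw [hTstar] at hst; linarith
    have hlohi : Tlo < Thi := by linarith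
    have hmaxT : T₀ ≤ max T₀ |T₁| := le_max_left _ _
    have hTlo0 : 0 ≤ Tlo := by linarith
    have hThi0 : 0 ≤ Thi := by linarith
    -- the common bound on the boundary of the rectangle
    set B : ℝ := (Ch + Cv) * (1 + Thi) ^ M with hB
    have hBh : ∀ z : ℂ, z.re ∈ Icc (-1 : ℝ) 2 → (|z.im| = Tlo ∨ |z.im| = Thi) → ‖θ z‖ ≤ B := by
      intro z hz hzT
      rcases hzT with h | h
      · calc ‖θ z‖ ≤ Ch * (1 + Tlo) ^ M := horiz Tlo hloM hTlo z hz h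
          _ ≤ Ch * (1 + Thi) ^ M := by gcongr
          _ ≤ B := by rw [hB]; nlinarith [pow_nonneg (by linarith : (0:ℝ) ≤ 1 + Thi) M,
            mul_nonneg (by positivity : (0:ℝ) ≤ Cv) (pow_nonneg (by linarith : (0:ℝ) ≤ 1 + Thi) M)]
      · calc ‖θ z‖ ≤ Ch * (1 + Thi) ^ M := horiz Thi hhiM hThi z hz h
          _ ≤ B := by rw [hB]; nlinarith [pow_nonneg (by linarith : (0:ℝ) ≤ 1 + Thi) M,
            mul_nonneg (by positivity : (0:ℝ) ≤ Cv) (pow_nonneg (by linarith : (0:ℝ) ≤ 1 + Thi) M)]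
    have hBv : ∀ z : ℂ, (z.re = -1 ∨ z.re = 2) → |z.im| ≤ Thi → ‖θ z‖ ≤ B := by
      intro z hz hzT
      calc ‖θ z‖ ≤ Cv * (1 + Thi) ^ M := vert z hz Thi hThi0 hzT
        _ ≤ B := by rw [hB]; nlinarith [pow_nonneg (by linarith : (0:ℝ) ≤ 1 + Thi) M,
            mul_nonneg hCh0 (pow_nonneg (by linarith : (0:ℝ) ≤ 1 + Thi) M)]
    -- the bound at `s`, by the maximum modulus principle on the rectangle on the correct side
    have hsB : ‖θ s‖ ≤ B := by
      rcases le_or_gt 0 s.im with hpos | hneg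
      · have hts : t = s.im := abs_of_nonneg hpos
        refine norm_le_of_rect hθd (x₁ := -1) (x₂ := 2) (y₁ := Tlo) (y₂ := Thi) (by norm_num) hlohi
          (fun z hz hzim ↦ hBh z hz ?_) (fun z hz hzim ↦ hBv z hz ?_) ⟨hs1, hs2⟩
          ⟨by linarith, by linarith⟩
        · have hz0 : 0 ≤ z.im := by rcases hzim with h | h <;> rw [h] <;> linarith
          rw [abs_of_nonneg hz0]; exact hzim
        · have hz0 : 0 ≤ z.im := by linarith [hzim.1]
          rw [abs_of_nonneg hz0]; exact hzim.2
      · have hts : t = -s.im := abs_of_neg hneg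
        refine norm_le_of_rect hθd (x₁ := -1) (x₂ := 2) (y₁ := -Thi) (y₂ := -Tlo) (by norm_num)
          (by linarith) (fun z hz hzim ↦ hBh z hz ?_) (fun z hz hzim ↦ hBv z hz ?_) ⟨hs1, hs2⟩
          ⟨by linarith, by linarith⟩
        · have hz0 : z.im ≤ 0 := by rcases hzim with h | h <;> rw [h] <;> linarith
          rw [abs_of_nonpos hz0]
          rcases hzim with h | h
          · right; rw [h]; ring
          · left; rw [h]; ring
        · have hz0 : z.im ≤ 0 := by linarith [hzim.2]
          rw [abs_of_nonpos hz0]; linarith [hzim.1]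
    -- `B ≤ Cfar (1 + ‖s‖)^M`
    refine hsB.trans ?_
    have h3 : 1 + Thi ≤ 3 * (1 + ‖s‖) := by
      have : t ≤ ‖s‖ := abs_im_le_norm s
      linarith [norm_nonneg s]
    calc B = (Ch + Cv) * (1 + Thi) ^ M := rfl
      _ ≤ (Ch + Cv) * (3 * (1 + ‖s‖)) ^ M := by gcongr
      _ = Cfar * (1 + ‖s‖) ^ M := by rw [hCfar, mul_pow]; ring
  -- near the real axis: compactness
  set Kc : Set ℂ := Icc (-1 : ℝ) 2 ×ℂ Icc (-Tstar) Tstar with hKc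
  have hKcpt : IsCompact Kc := isCompact_Icc.reProdIm isCompact_Icc
  obtain ⟨M₀, hM₀⟩ := hKcpt.exists_bound_of_continuousOn hθd.continuous.continuousOn
  -- assembly
  refine ⟨max M₀ 0 + Cfar, by positivity, M, by rw [hM]; omega, fun s hs1 hs2 ↦ ?_⟩
  have h1 : 1 ≤ (1 + ‖s‖) ^ M := one_le_pow₀ (by linarith [norm_nonneg s])
  have hCfar0 : 0 ≤ Cfar := by positivity
  rcases le_or_gt Tstar |s.im| with hfar | hnear
  · calc ‖θ s‖ ≤ Cfar * (1 + ‖s‖) ^ M := far s hs1 hs2 hfar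
      _ ≤ (max M₀ 0 + Cfar) * (1 + ‖s‖) ^ M := by gcongr; linarith [le_max_right M₀ 0]
  · have hsK : s ∈ Kc := ⟨⟨hs1, hs2⟩, abs_le.1 hnear.le⟩
    calc ‖θ s‖ ≤ M₀ := hM₀ s hsK
      _ ≤ max M₀ 0 * 1 := by rw [mul_one]; exact le_max_left _ _
      _ ≤ (max M₀ 0 + Cfar) * (1 + ‖s‖) ^ M :=
          mul_le_mul (by linarith) h1 zero_le_one (by positivity)

end Strip

/-! ## F. Decay of `θ` along the real axis; `θ` is a polynomial; `θ = 0` -/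

/-- **Cauchy–Schwarz form of the tail bound**: for `g ∈ L²(ℝ)`, `a > 0`, `σ = Re s > 1/2`,
`‖∫_a^∞ g(t)t^{−s}dt‖ ≤ √(a^{1−2σ}/(2σ−1))·(‖g‖²+1)/2` (the AM–GM bound of `BurnolLProperty` applied to
`√B·g`, `B = a^{1−2σ}/(2σ−1)`). [cite: Burnol2004b, proof of Thm. 4.8 (arXiv:math/0203120v7 p. 10, TeX l.857–858)] -/
theorem norm_tail_le {a : ℝ} (ha : 0 < a) (g : Lp ℂ 2 (volume : Measure ℝ)) {s : ℂ}
    (hs : 1 / 2 < s.re) :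
    ‖mellin ((Ioi a).indicator (g : ℝ → ℂ)) (1 - s)‖ ≤
      Real.sqrt (a ^ (1 - 2 * s.re) / (2 * s.re - 1)) * (‖g‖ ^ 2 + 1) / 2 := by
  set B : ℝ := a ^ (1 - 2 * s.re) / (2 * s.re - 1) with hB
  have hB0 : 0 < B := div_pos (Real.rpow_pos_of_pos ha _) (by linarith)
  set t : ℝ := Real.sqrt B with ht
  have ht0 : 0 < t := Real.sqrt_pos.2 hB0
  have htt : t ^ 2 = B := Real.sq_sqrt hB0.le
  have key := BurnolLProperty.norm_mellin_indicator_le ha ((t : ℂ) • g) hs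
  -- `mellin` of `t • g` and `∫ ‖t • g‖²`
  have h1 : mellin ((Ioi a).indicator ((((t : ℂ) • g : Lp ℂ 2 (volume : Measure ℝ)) : ℝ → ℂ)))
      (1 - s) = (t : ℂ) * mellin ((Ioi a).indicator (g : ℝ → ℂ)) (1 - s) := by
    simp only [mellin]
    rw [← integral_const_mul]
    refine integral_congr_ae ?_
    filter_upwards [ae_restrict_of_ae (Lp.coeFn_smul (t : ℂ) g)] with x hx
    by_cases hxa : x ∈ Ioi a
    · simp only [indicator_of_mem hxa, hx, Pi.smul_apply, smul_eq_mul]; ring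
    · simp only [indicator_of_notMem hxa, smul_zero, mul_zero]
  have h2 : ∫ x, ‖((((t : ℂ) • g : Lp ℂ 2 (volume : Measure ℝ)) : ℝ → ℂ)) x‖ ^ 2 =
      t ^ 2 * ‖g‖ ^ 2 := by
    rw [Literature.Analysis.FunctionSpaces.MellinL2.integral_norm_sq_eq_norm_sq, norm_smul, mul_pow,
      Complex.norm_real, Real.norm_of_nonneg ht0.le]
  rw [h1, h2, norm_mul, Complex.norm_real, Real.norm_of_nonneg ht0.le, htt, ← hB] at key
  -- `t‖X‖ ≤ (B‖g‖² + B)/2 = t·(t(‖g‖²+1)/2)`, i.e. `‖X‖ ≤ t(‖g‖²+1)/2`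
  have : t * ‖mellin ((Ioi a).indicator (g : ℝ → ℂ)) (1 - s)‖ ≤ t * (t * (‖g‖ ^ 2 + 1) / 2) := by
    calc t * ‖mellin ((Ioi a).indicator (g : ℝ → ℂ)) (1 - s)‖ ≤ (B * ‖g‖ ^ 2 + B) / 2 := key
      _ = t * (t * (‖g‖ ^ 2 + 1) / 2) := by rw [← htt]; ring
  have h := le_of_mul_le_mul_left this ht0
  linarith

/-- Exponential beats polynomial: `(1+σ)^N · a^{κ−σ} → 0` as `σ → +∞`, for `a > 1`. [folklore] -/
private theorem tendsto_pow_mul_rpow_sub {a : ℝ} (ha : 1 < a) (N : ℕ) (κ : ℝ) :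
    Tendsto (fun σ : ℝ ↦ (1 + σ) ^ N * a ^ (κ - σ)) atTop (𝓝 0) := by
  have ha0 : 0 < a := by linarith
  set L : ℝ := Real.log a with hL
  have hL0 : 0 < L := Real.log_pos ha
  have hx : Tendsto (fun σ : ℝ ↦ L * (1 + σ)) atTop atTop :=
    (tendsto_atTop_add_const_left _ 1 tendsto_id).const_mul_atTop hL0
  have h := ((Real.tendsto_pow_mul_exp_neg_atTop_nhds_zero N).comp hx).const_mul (Real.exp (L * κ + L) / L ^ N)
  rw [mul_zero] at h
  refine h.congr fun σ ↦ ?_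
  simp only [Function.comp_def]
  rw [Real.rpow_def_of_pos ha0, ← hL, mul_pow]
  calc Real.exp (L * κ + L) / L ^ N * (L ^ N * (1 + σ) ^ N * Real.exp (-(L * (1 + σ))))
      = (1 + σ) ^ N * (Real.exp (L * κ + L) * Real.exp (-(L * (1 + σ)))) := by
        field_simp
    _ = (1 + σ) ^ N * Real.exp (L * (κ - σ)) := by rw [← Real.exp_add]; congr 1; ring

/-- **Coefficients of a vanishing "polynomial along the reals"**: if `σ ↦ Σ_{k<n} c_k σ^k → 0` as the
real `σ → +∞`, all `c_k` vanish. [folklore] -/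
private theorem coeff_eq_zero_of_tendsto_zero :
    ∀ (n : ℕ) (c : ℕ → ℂ),
      Tendsto (fun σ : ℝ ↦ ∑ k ∈ Finset.range n, c k * (σ : ℂ) ^ k) atTop (𝓝 0) →
        ∀ k, k < n → c k = 0 := by
  intro n
  induction n with
  | zero => intro c _ k hk; exact absurd hk (Nat.not_lt_zero k)
  | succ n ih =>
    intro c hc k hk
    -- the top coefficient vanishes: `S(σ)/σ^n → c n` and `→ 0`
    have htop : c n = 0 := by
      have hterm : ∀ j ∈ Finset.range (n + 1), Tendsto (fun σ : ℝ ↦ c j * (σ : ℂ) ^ j / (σ : ℂ) ^ n)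
          atTop (𝓝 (if j = n then c n else 0)) := by
        intro j hj
        by_cases hjn : j = n
        · subst hjn
          simp only [if_true]
          refine tendsto_const_nhds.congr' ?_
          filter_upwards [eventually_gt_atTop (0 : ℝ)] with σ hσ
          rw [mul_div_assoc, div_self (pow_ne_zero _ (ofReal_ne_zero.2 hσ.ne')), mul_one]
        · simp only [hjn, if_false]
          have hlt : j < n := lt_of_le_of_ne (Nat.lt_succ_iff.1 (Finset.mem_range.1 hj)) hjn
          have h0 : Tendsto (fun σ : ℝ ↦ ((σ : ℂ) ^ (n - j))⁻¹) atTop (𝓝 0) := by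
            have hr : Tendsto (fun σ : ℝ ↦ (σ ^ (n - j))⁻¹) atTop (𝓝 0) :=
              (tendsto_pow_atTop (by omega)).inv_tendsto_atTop
            have h' := (continuous_ofReal.tendsto 0).comp hr
            rw [ofReal_zero] at h'
            refine h'.congr fun σ ↦ ?_
            simp
          have h2 := h0.const_mul (c j)
          rw [mul_zero] at h2
          refine h2.congr' ?_
          filter_upwards [eventually_gt_atTop (0 : ℝ)] with σ hσ
          have hσ' : (σ : ℂ) ≠ 0 := ofReal_ne_zero.2 hσ.ne'
          rw [show (σ : ℂ) ^ n = (σ : ℂ) ^ j * (σ : ℂ) ^ (n - j) by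
            rw [← pow_add, Nat.add_sub_cancel' hlt.le]]
          field_simp
      have h1 : Tendsto (fun σ : ℝ ↦ (∑ j ∈ Finset.range (n + 1), c j * (σ : ℂ) ^ j) / (σ : ℂ) ^ n)
          atTop (𝓝 (c n)) := by
        have hsum := tendsto_finsetSum (Finset.range (n + 1)) hterm
        simp only [Finset.sum_ite_eq', Finset.mem_range, Nat.lt_succ_self, if_true] at hsum
        refine hsum.congr fun σ ↦ ?_
        rw [Finset.sum_div]
      have h2 : Tendsto (fun σ : ℝ ↦ (∑ j ∈ Finset.range (n + 1), c j * (σ : ℂ) ^ j) / (σ : ℂ) ^ n)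
          atTop (𝓝 0) := by
        refine squeeze_zero_norm' ?_ (tendsto_zero_iff_norm_tendsto_zero.1 hc)
        filter_upwards [eventually_ge_atTop (1 : ℝ)] with σ hσ
        rw [norm_div, norm_pow, Complex.norm_real, Real.norm_of_nonneg (by linarith)]
        exact div_le_self (norm_nonneg _) (one_le_pow₀ hσ)
      exact tendsto_nhds_unique h1 h2
    rcases Nat.lt_succ_iff_lt_or_eq.1 hk with hk' | rfl
    · refine ih c ?_ k hk'
      refine hc.congr fun σ ↦ ?_
      rw [Finset.sum_range_succ, htop, zero_mul, add_zero]
    · exact htop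

/-- **An entire function of polynomial growth tending to `0` along the positive real axis vanishes**
(Liouville for polynomial growth + the coefficients lemma). [folklore] -/
private theorem eq_zero_of_growth_of_tendsto {θ : ℂ → ℂ} (hθd : Differentiable ℂ θ) {C : ℝ} {M : ℕ}
    (hb : ∀ s : ℂ, ‖θ s‖ ≤ C * (1 + ‖s‖) ^ M)
    (hlim : Tendsto (fun σ : ℝ ↦ θ σ) atTop (𝓝 0)) : ∀ s, θ s = 0 := by
  -- growth `‖θ q‖ ≤ C 2^M ‖q‖^M` for `‖q‖ ≥ 1`
  have hC0 : 0 ≤ C := by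
    have := hb 0
    have h1 : (0 : ℝ) < (1 + ‖(0 : ℂ)‖) ^ M := by positivity
    nlinarith [norm_nonneg (θ 0)]
  have hgrowth : ∀ q : ℂ, 1 ≤ ‖q‖ → ‖θ q‖ ≤ C * 2 ^ M * ‖q‖ ^ (M : ℝ) := by
    intro q hq
    rw [Real.rpow_natCast]
    calc ‖θ q‖ ≤ C * (1 + ‖q‖) ^ M := hb q
      _ ≤ C * (2 * ‖q‖) ^ M := by gcongr; linarith
      _ = C * 2 ^ M * ‖q‖ ^ M := by rw [mul_pow]; ring
  obtain ⟨c, hc⟩ := Literature.Analysis.Complex.exists_eq_sum_of_differentiable_of_growth (M + 1) θ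
    (M : ℝ) (C * 2 ^ M) (by push_cast; linarith) hθd hgrowth
  have hlim' : Tendsto (fun σ : ℝ ↦ ∑ k ∈ Finset.range (M + 1), c k * (σ : ℂ) ^ k) atTop (𝓝 0) :=
    hlim.congr fun σ ↦ hc σ
  have hzero := coeff_eq_zero_of_tendsto_zero (M + 1) c hlim'
  intro s
  rw [hc s]
  exact Finset.sum_eq_zero fun k hk ↦ by rw [hzero k (Finset.mem_range.1 hk), zero_mul]

section Decay

variable {a : ℝ} {f : Lp ℂ 2 (volume : Measure ℝ)} {P : ℂ → ℂ} {CP : ℝ} {N : ℕ} {θ : ℂ → ℂ}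

/-- **`θ(σ) → 0` along the positive real axis** (`a ≥ 1`, and `a > 1` unless the weight is trivial):
`|G_f(σ)| ≤ |c|a^{1−σ}/(σ−1) + √(a^{1−2σ}/(2σ−1))(‖f‖²+1)/2`, `|P_R(σ)| ≤ C(1+σ)^N`, `|1/ζ(σ)| ≤ C_ζ`.
[cite: Burnol2004b, proof of Prop. 6.1 ("`G(s)/ζ(s)` is `O(A^{Re s})`", arXiv:math/0203120v7 p. 15, TeX l.1228–1232)] -/
theorem tendsto_theta_real (ha1 : 1 ≤ a) (hf : f ∈ sonineL a) (hNa : N = 0 ∨ 1 < a)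
    (hCP : 0 ≤ CP) (hPn : ∀ z : ℂ, ‖P z‖ ≤ CP * (1 + ‖z‖) ^ N)
    (hθ : ∀ s, s ≠ 1 → riemannZeta s ≠ 0 →
      θ s = rightMellinExt f s * P s / riemannZeta s) :
    Tendsto (fun σ : ℝ ↦ θ σ) atTop (𝓝 0) := by
  have ha : 0 < a := by linarith
  obtain ⟨c, hgc⟩ := hf.2.1
  have hex : ∃ G, HasRightMellinContinuation f G :=
    ⟨_, hasRightMellinContinuation_rightMellinExt_of_mem_sonineL ha hf⟩
  obtain ⟨Cζ, hCζ0, hCζ⟩ := exists_bound_inv_zeta_two_le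
  set K : ℝ := (‖f‖ ^ 2 + 1) / 2 with hK
  -- the pointwise bound for real `σ ≥ 2`
  have hbd : ∀ σ : ℝ, 2 ≤ σ → ‖θ σ‖ ≤ Cζ * (CP * (1 + σ) ^ N) *
      (‖c‖ * a ^ (1 - σ) / (σ - 1) + Real.sqrt (a ^ (1 - 2 * σ) / (2 * σ - 1)) * K) := by
    intro σ hσ
    have hs1 : (σ : ℂ) ≠ 1 := by
      intro h; have := congrArg Complex.re h; simp at this; linarith
    have hζ : riemannZeta σ ≠ 0 := riemannZeta_ne_zero_of_one_le_re (by simp; linarith)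
    have hσre : (σ : ℂ).re = σ := ofReal_re σ
    have hG : ‖rightMellinExt f σ‖ ≤
        ‖c‖ * a ^ (1 - σ) / (σ - 1) + Real.sqrt (a ^ (1 - 2 * σ) / (2 * σ - 1)) * K := by
      rw [BurnolLProperty.rightMellinExt_eq_polar_add_mellin ha hgc hex (s := σ)
        (by rw [hσre]; linarith) hs1]
      refine (norm_add_le _ _).trans (add_le_add (le_of_eq ?_) ?_)
      · rw [norm_div, norm_mul, Complex.norm_cpow_eq_rpow_re_of_pos ha, sub_re, one_re, hσre,
          show (1 : ℂ) - σ = ((1 - σ : ℝ) : ℂ) by push_cast; ring, Complex.norm_real, Real.norm_eq_abs,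
          abs_of_nonpos (by linarith), neg_sub]
      · have h := norm_tail_le ha f (s := σ) (by rw [hσre]; linarith)
        rw [hσre] at h
        rw [hK]
        linarith
    have hP : ‖P σ‖ ≤ CP * (1 + σ) ^ N := by
      have h := hPn σ
      rwa [Complex.norm_real, Real.norm_of_nonneg (by linarith)] at h
    rw [hθ σ hs1 hζ, div_eq_mul_inv, norm_mul, norm_mul]
    have hσ2 : 2 ≤ (σ : ℂ).re := by rw [hσre]; exact hσ
    have hK0 : 0 ≤ K := by positivity
    have hnn1 : 0 ≤ ‖c‖ * a ^ (1 - σ) / (σ - 1) + Real.sqrt (a ^ (1 - 2 * σ) / (2 * σ - 1)) * K :=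
      add_nonneg (div_nonneg (mul_nonneg (norm_nonneg _) (Real.rpow_nonneg ha.le _)) (by linarith))
        (mul_nonneg (Real.sqrt_nonneg _) hK0)
    have hnn2 : 0 ≤ CP * (1 + σ) ^ N :=
      mul_nonneg hCP (pow_nonneg (by linarith) _)
    calc ‖rightMellinExt f σ‖ * ‖P σ‖ * ‖(riemannZeta σ)⁻¹‖
        ≤ (‖c‖ * a ^ (1 - σ) / (σ - 1) + Real.sqrt (a ^ (1 - 2 * σ) / (2 * σ - 1)) * K) *
          (CP * (1 + σ) ^ N) * Cζ :=
          mul_le_mul (mul_le_mul hG hP (norm_nonneg _) hnn1) (hCζ _ hσ2)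
            (norm_nonneg _) (mul_nonneg hnn1 hnn2)
      _ = _ := by ring
  rcases hNa with hN0 | ha'
  · -- trivial weight: `N = 0`
    have hmaj : ∀ᶠ σ : ℝ in atTop, ‖θ σ‖ ≤ Cζ * CP *
        (‖c‖ * (σ - 1)⁻¹ + Real.sqrt ((2 * σ - 1)⁻¹) * K) := by
      filter_upwards [eventually_ge_atTop (2 : ℝ)] with σ hσ
      refine (hbd σ hσ).trans ?_
      rw [hN0, pow_zero, mul_one]
      have h1 : a ^ (1 - σ) ≤ 1 := Real.rpow_le_one_of_one_le_of_nonpos ha1 (by linarith)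
      have h2 : a ^ (1 - 2 * σ) ≤ 1 := Real.rpow_le_one_of_one_le_of_nonpos ha1 (by linarith)
      have h3 : Real.sqrt (a ^ (1 - 2 * σ) / (2 * σ - 1)) ≤ Real.sqrt ((2 * σ - 1)⁻¹) := by
        refine Real.sqrt_le_sqrt ?_
        rw [div_eq_mul_inv]
        exact mul_le_of_le_one_left (inv_nonneg.2 (by linarith)) h2
      have h4 : ‖c‖ * a ^ (1 - σ) / (σ - 1) ≤ ‖c‖ * (σ - 1)⁻¹ := by
        rw [div_eq_mul_inv]
        exact mul_le_mul_of_nonneg_right (mul_le_of_le_one_right (norm_nonneg _) h1)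
          (inv_nonneg.2 (by linarith))
      have hK0 : 0 ≤ K := by positivity
      gcongr
    refine squeeze_zero_norm' hmaj ?_
    have hl1 : Tendsto (fun σ : ℝ ↦ (σ - 1)⁻¹) atTop (𝓝 0) :=
      tendsto_inv_atTop_zero.comp (tendsto_atTop_add_const_right _ (-1) tendsto_id)
    have hl2 : Tendsto (fun σ : ℝ ↦ Real.sqrt ((2 * σ - 1)⁻¹)) atTop (𝓝 0) := by
      have h2 : Tendsto (fun σ : ℝ ↦ (2 * σ - 1)⁻¹) atTop (𝓝 0) :=
        tendsto_inv_atTop_zero.comp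
          (tendsto_atTop_add_const_right _ (-1) (tendsto_id.const_mul_atTop two_pos))
      have := (Real.continuous_sqrt.tendsto 0).comp h2
      rwa [Function.comp_def, Real.sqrt_zero] at this
    have := ((hl1.const_mul ‖c‖).add (hl2.mul_const K)).const_mul (Cζ * CP)
    simpa using this
  · -- `a > 1`: exponential decay beats the weight
    have hmaj : ∀ᶠ σ : ℝ in atTop, ‖θ σ‖ ≤ Cζ * CP *
        (‖c‖ * ((1 + σ) ^ N * a ^ (1 - σ)) + K * ((1 + σ) ^ N * a ^ (1 / 2 - σ))) := by
      filter_upwards [eventually_ge_atTop (2 : ℝ)] with σ hσ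
      refine (hbd σ hσ).trans ?_
      have h1 : ‖c‖ * a ^ (1 - σ) / (σ - 1) ≤ ‖c‖ * a ^ (1 - σ) := by
        rw [div_le_iff₀ (by linarith)]
        exact le_mul_of_one_le_right (by positivity) (by linarith)
      have h2 : Real.sqrt (a ^ (1 - 2 * σ) / (2 * σ - 1)) ≤ a ^ (1 / 2 - σ) := by
        calc Real.sqrt (a ^ (1 - 2 * σ) / (2 * σ - 1)) ≤ Real.sqrt (a ^ (1 - 2 * σ)) := by
              refine Real.sqrt_le_sqrt (div_le_self (by positivity) (by linarith))
          _ = a ^ (1 / 2 - σ) := by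
              rw [Real.sqrt_eq_rpow, ← Real.rpow_mul ha.le]; congr 1; ring
      have hK0 : 0 ≤ K := by positivity
      calc Cζ * (CP * (1 + σ) ^ N) *
            (‖c‖ * a ^ (1 - σ) / (σ - 1) + Real.sqrt (a ^ (1 - 2 * σ) / (2 * σ - 1)) * K)
          ≤ Cζ * (CP * (1 + σ) ^ N) * (‖c‖ * a ^ (1 - σ) + a ^ (1 / 2 - σ) * K) := by
            gcongr
        _ = _ := by ring
    refine squeeze_zero_norm' hmaj ?_
    have hl1 := tendsto_pow_mul_rpow_sub ha' N 1
    have hl2 := tendsto_pow_mul_rpow_sub ha' N (1 / 2)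
    have := ((hl1.const_mul ‖c‖).add (hl2.const_mul K)).const_mul (Cζ * CP)
    simpa using this

end Decay

/-! ## G. The engine: `G_f ≡ 0`, hence `f = 0` -/

section Engine

variable {a : ℝ} {f : Lp ℂ 2 (volume : Measure ℝ)}

/-- **The Kreĭn-free engine.** Let `a ≥ 1`, `f ∈ L_a`, and `R` a finite set of non-trivial zeros
(empty unless `a > 1`). If `G_f` vanishes at every non-trivial zero `ρ ∉ R` to order `≥ m(ρ)`, then
`G_f ≡ 0` off `s = 1`: the entire quotient `θ = G_f·P_R/ζ` has polynomial growth (right half-plane,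
functional equation on the left, Titchmarsh 9.7 rectangles in the strip), hence is a polynomial, and
tends to `0` along the real axis. (Replaces Kreĭn's theorem in the printed proof.)
[cite: Burnol2004b, proofs of Props. 6.1–6.2 (arXiv:math/0203120v7 p. 15, TeX l.1208–1257); Titchmarsh1986, Thm. 9.7] -/
theorem rightMellinExt_eq_zero_of_vanishing (ha1 : 1 ≤ a) (hf : f ∈ sonineL a)
    {P : ℂ → ℂ} (hPa : ∀ s, AnalyticAt ℂ P s) {CP : ℝ} (hCP : 0 ≤ CP) {N : ℕ}
    (hPn : ∀ z : ℂ, ‖P z‖ ≤ CP * (1 + ‖z‖) ^ N) (hP2 : ∀ s : ℂ, 2 ≤ s.re → P s ≠ 0)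
    (hNa : N = 0 ∨ 1 < a) (R : Finset ℂ)
    (hPR : ∀ ρ ∈ R, (((riemannZetaZeroOrder ρ).toNat : ℤ) : WithTop ℤ) ≤ meromorphicOrderAt P ρ)
    (hvan : ∀ ρ ∈ ZetaZeros.riemannZetaNontrivialZeros, ρ ∉ R →
      (((riemannZetaZeroOrder ρ).toNat : ℕ) : ℕ∞) ≤ analyticOrderAt (rightMellinExt f) ρ) :
    ∀ s : ℂ, s ≠ 1 → rightMellinExt f s = 0 := by
  have ha : 0 < a := by linarith
  obtain ⟨θ, hθd, -, hθ⟩ := exists_theta ha hf hPa R hPR hvan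
  obtain ⟨C₁, hC₁0, hC₁⟩ := exists_bound_theta_right ha1 hf hCP hPn hθ
  obtain ⟨C₂, hC₂0, hC₂⟩ := exists_bound_theta_left_of_ne ha1 hf hCP hPn hθ
  obtain ⟨C₃, hC₃0, hC₃⟩ := exists_bound_theta_left ha1 hf hθd hCP hPn hθ
  obtain ⟨C₄, hC₄0, M, hNM, hC₄⟩ :=
    exists_bound_theta_strip ha hf hθd hCP hPn hθ hC₁0 hC₁ hC₂0 hC₂
  -- global polynomial bound
  have hglob : ∀ s : ℂ, ‖θ s‖ ≤ (C₁ + C₃ + C₄) * (1 + ‖s‖) ^ M := by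
    intro s
    have h1 : (1 + ‖s‖) ^ N ≤ (1 + ‖s‖) ^ M :=
      pow_le_pow_right₀ (by linarith [norm_nonneg s]) hNM
    have hpos : 0 ≤ (1 + ‖s‖) ^ M := by positivity
    rcases le_or_gt 2 s.re with h | h
    · calc ‖θ s‖ ≤ C₁ * (1 + ‖s‖) ^ N := hC₁ s h
        _ ≤ C₁ * (1 + ‖s‖) ^ M := by gcongr
        _ ≤ (C₁ + C₃ + C₄) * (1 + ‖s‖) ^ M := by gcongr; linarith
    rcases le_or_gt s.re (-1) with h' | h'
    · calc ‖θ s‖ ≤ C₃ * (1 + ‖s‖) ^ N := hC₃ s h'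
        _ ≤ C₃ * (1 + ‖s‖) ^ M := by gcongr
        _ ≤ (C₁ + C₃ + C₄) * (1 + ‖s‖) ^ M := by gcongr; linarith
    · calc ‖θ s‖ ≤ C₄ * (1 + ‖s‖) ^ M := hC₄ s h'.le h.le
        _ ≤ (C₁ + C₃ + C₄) * (1 + ‖s‖) ^ M := by gcongr; linarith
  have hθ0 := eq_zero_of_growth_of_tendsto hθd hglob (tendsto_theta_real ha1 hf hNa hCP hPn hθ)
  -- `G_f = 0` on `Re s ≥ 2`
  have hG2 : ∀ s : ℂ, 2 ≤ s.re → rightMellinExt f s = 0 := by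
    intro s hs
    have hs1 : s ≠ 1 := by intro h; rw [h, one_re] at hs; norm_num at hs
    have hζ : riemannZeta s ≠ 0 := riemannZeta_ne_zero_of_one_le_re (by linarith)
    have hP : P s ≠ 0 := hP2 s hs
    have h := hθ s hs1 hζ
    rw [hθ0 s, eq_comm, div_eq_zero_iff, mul_eq_zero] at h
    rcases h with (h | h) | h
    · exact h
    · exact absurd h hP
    · exact absurd h hζ
  -- identity theorem on `ℂ ∖ {1}`
  have hanal : AnalyticOnNhd ℂ (rightMellinExt f) {s : ℂ | s ≠ 1} :=
    (hasRightMellinContinuation_rightMellinExt_of_mem_sonineL ha hf).1.analyticOnNhd isOpen_ne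
  have hev : rightMellinExt f =ᶠ[𝓝 (3 : ℂ)] 0 := by
    filter_upwards [(isOpen_lt continuous_const Complex.continuous_re).mem_nhds
      (show (2 : ℝ) < (3 : ℂ).re by norm_num)] with z hz using hG2 z (le_of_lt hz)
  intro s hs1
  exact hanal.eqOn_zero_of_preconnected_of_eventuallyEq_zero
    (isConnected_compl_singleton_of_one_lt_rank (by simp) (1 : ℂ)).isPreconnected
    (show (3 : ℂ) ≠ 1 by norm_num) hev hs1

/-- **Injectivity**: `f ∈ L_a` (`a ≥ 1`) with `G_f ≡ 0` off `s = 1` is `0` (Mellin–Plancherel on the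
critical line, `𝓜(res f) = G_f(½ − 2πiξ)` a.e., and `‖f‖² = 2‖res f‖²` for even classes).
[cite: Burnol2004b, §1 eq. (1.1) (arXiv:math/0203120v7 p. 4, TeX l.350–355)] -/
theorem eq_zero_of_rightMellinExt_eq_zero (ha1 : 1 ≤ a) (hf : f ∈ sonineL a)
    (hG : ∀ s : ℂ, s ≠ 1 → rightMellinExt f s = 0) : f = 0 := by
  have hf1 : f ∈ sonineL 1 := BurnolEvaluatorsMinimal.sonineL_antitone ha1 hf
  have hM := BurnolZetaQuotientCompleteness.mellinL2_resPos_ae_eq hf1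
  set r := (LpToLpRestrictCLM ℝ ℂ ℂ (volume : Measure ℝ) 2 (Ioi (0 : ℝ))) f with hr
  have hzero : (Literature.Analysis.FunctionSpaces.MellinL2.mellinL2 r : ℝ → ℂ) =ᵐ[volume]
      (0 : Lp ℂ 2 (volume : Measure ℝ)) := by
    refine hM.trans (EventuallyEq.trans (Eventually.of_forall fun ξ ↦ ?_) (Lp.coeFn_zero _ _ _).symm)
    refine hG _ ?_
    intro h
    have := congrArg Complex.re h
    norm_num at this
  have h0 : Literature.Analysis.FunctionSpaces.MellinL2.mellinL2 r = 0 := Lp.ext hzero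
  have hres : r = 0 := by
    have h := congrArg (Literature.Analysis.FunctionSpaces.MellinL2.mellinL2).symm h0
    simpa using h
  have hn := BurnolZetaQuotientCompleteness.norm_sq_eq_two_mul_norm_sq_resPos (h := f) hf.1
  rw [← hr, hres, norm_zero] at hn
  have : ‖f‖ = 0 := by nlinarith [norm_nonneg f]
  exact norm_eq_zero.1 this

end Engine

/-! ## H. From orthogonality to the evaluators to vanishing orders -/

section Hilbert

variable {a : ℝ}

/-- If the conjugate class vanishes, so does the class. [folklore] -/
private theorem eq_zero_of_conj_eq_zero {u v : Lp ℂ 2 (volume : Measure ℝ)}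
    (hv : (v : ℝ → ℂ) =ᵐ[volume] fun x ↦ conj ((u : ℝ → ℂ) x)) (h0 : v = 0) : u = 0 := by
  refine Lp.ext (EventuallyEq.trans ?_ (Lp.coeFn_zero _ _ _).symm)
  rw [h0] at hv
  filter_upwards [hv, Lp.coeFn_zero ℂ 2 (volume : Measure ℝ)] with x hx hx0
  rw [hx0] at hx
  have := congrArg conj hx.symm
  simpa using this

/-- **Orthogonality to `Y^a_{ρ,k}` in the Hermitian sense is the vanishing of the evaluation of the
conjugate**: `⟪Y^a_{ρ,k}, g⟫ = 0 ⇒ M(ḡ)^{(k)}(ρ) = 0` (`[ḡ, Y] = ∫₀^∞ ḡ Y = conj(½⟪Y, g⟫)`).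
[cite: Burnol2004b, §2 (arXiv:math/0203120v7 p. 5, TeX l.472–481)] -/
theorem burnolEval_conj_eq_zero (ha : 0 < a) {g v : Lp ℂ 2 (volume : Measure ℝ)} (hg : g ∈ sonineL a)
    (hv : (v : ℝ → ℂ) =ᵐ[volume] fun x ↦ conj ((g : ℝ → ℂ) x))
    (p : ZetaZeroIndex) (horth : inner ℂ (burnolYSystem a p) g = 0) :
    burnolEval v p.1.1 p.1.2 = 0 := by
  have hY := BurnolEvaluators.isBurnolY_burnolYSystem ha p
  rw [← hY.2 v (BurnolEvaluators.mem_sonineL_of_conj hg hv)]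
  -- `∫₀^∞ ḡ·Y = conj (∫₀^∞ g · conj Y) = conj (½ ⟪Y, g⟫) = 0`
  have h1 : ∫ t in Ioi (0 : ℝ), (v : ℝ → ℂ) t * (burnolYSystem a p : ℝ → ℂ) t =
      conj (∫ t in Ioi (0 : ℝ), (g : ℝ → ℂ) t * conj ((burnolYSystem a p : ℝ → ℂ) t)) := by
    rw [← integral_conj]
    refine integral_congr_ae ?_
    filter_upwards [ae_restrict_of_ae hv] with t ht
    rw [ht, map_mul, conj_conj]
  rw [h1, BurnolEvaluators.setIntegral_mul_conj_eq_half_inner hg.1 hY.1.1, horth]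
  simp

/-- `Γ_ℝ` is analytic off its poles (`1/Γ_ℝ` is entire). [folklore] -/
private theorem analyticAt_Gammaℝ_of_ne_zero {w : ℂ} (hw : Gammaℝ w ≠ 0) : AnalyticAt ℂ Gammaℝ w := by
  -- adapted from `BurnolSonineEvaluators.lean` (private there)
  have h := (differentiable_Gammaℝ_inv.analyticAt w).inv (inv_ne_zero hw)
  have e : (fun z : ℂ ↦ (Gammaℝ z)⁻¹)⁻¹ = Gammaℝ := by funext z; simp
  rwa [e] at h

/-- From the vanishing of all evaluations `M(v)^{(k)}(ρ) = 0`, `k < m(ρ)`, to the analytic order of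
`G_v` at `ρ` (`Γ_ℝ(ρ) ≠ 0`). [cite: Burnol2004b, proof of Prop. 6.1 ("`G(s)` factorizes as `ζ(s)θ(s)`", arXiv:math/0203120v7 p. 15, TeX l.1210–1212)] -/
theorem le_analyticOrderAt_of_burnolEval_eq_zero (ha : 0 < a) {v : Lp ℂ 2 (volume : Measure ℝ)}
    (hv : v ∈ sonineL a) {ρ : ℂ} (hρ : ρ ∈ ZetaZeros.riemannZetaNontrivialZeros)
    (h : ∀ k : ℕ, (k : ℤ) < riemannZetaZeroOrder ρ → burnolEval v ρ k = 0) :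
    (((riemannZetaZeroOrder ρ).toNat : ℕ) : ℕ∞) ≤ analyticOrderAt (rightMellinExt v) ρ := by
  obtain ⟨h0, h1, hn⟩ := BurnolEvaluators.admissible_of_mem_nontrivialZeros hρ
  have hΓ : Gammaℝ ρ ≠ 0 := by
    rw [Ne, Gammaℝ_eq_zero_iff]
    rintro ⟨n, hn'⟩
    rcases n with _ | k
    · exact h0 (by simpa using hn')
    · exact hn k (by rw [hn']; push_cast; ring)
  have hM : AnalyticAt ℂ (completedMellin v) ρ := BurnolEvaluators.analyticAt_completedMellin ha hv h1 hΓ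
  have hG : AnalyticAt ℂ (rightMellinExt v) ρ :=
    (hasRightMellinContinuation_rightMellinExt_of_mem_sonineL ha hv).1.analyticAt (isOpen_ne.mem_nhds h1)
  -- order of `M(v) = Γ_ℝ · G_v` at `ρ`
  have hordM : (((riemannZetaZeroOrder ρ).toNat : ℕ) : ℕ∞) ≤ analyticOrderAt (completedMellin v) ρ := by
    rw [natCast_le_analyticOrderAt_iff_iteratedDeriv_eq_zero hM]
    intro i hi
    exact h i (by have := riemannZetaZeroOrder_nonneg h1; omega)
  have hprod : analyticOrderAt (completedMellin v) ρ =
      analyticOrderAt Gammaℝ ρ + analyticOrderAt (rightMellinExt v) ρ := by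
    rw [show completedMellin v = Gammaℝ * rightMellinExt v from rfl]
    exact analyticOrderAt_mul (analyticAt_Gammaℝ_of_ne_zero hΓ) hG
  have hΓ0 : analyticOrderAt Gammaℝ ρ = 0 := (analyticAt_Gammaℝ_of_ne_zero hΓ).analyticOrderAt_eq_zero.2 hΓ
  rw [hprod, hΓ0, zero_add] at hordM
  exact hordM

end Hilbert

/-! ## I. Completeness of the evaluators: Props. 6.1 and 6.2 -/

section Completeness

variable {a : ℝ}

/-- **The orthogonality criterion.** For `a ≥ 1` and a finite set `S` of indices (empty unless
`a > 1`), every `g ∈ L_a` orthogonal to all `Y^a_{ρ,k}`, `(ρ,k) ∉ S`, vanishes.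
[cite: Burnol2004b, Props. 6.1–6.2 (arXiv:math/0203120v7 p. 15, TeX l.1203–1257)] -/
theorem eq_zero_of_orthogonal (ha1 : 1 ≤ a) (S : Finset ZetaZeroIndex) (hSa : S = ∅ ∨ 1 < a)
    {g : Lp ℂ 2 (volume : Measure ℝ)} (hg : g ∈ sonineL a)
    (horth : ∀ p : ZetaZeroIndex, p ∉ S → inner ℂ (burnolYSystem a p) g = 0) : g = 0 := by
  classical
  have ha : 0 < a := by linarith
  set R : Finset ℂ := S.image (fun p ↦ p.1.1) with hRdef
  have hR : ∀ ρ ∈ R, ρ ∈ ZetaZeros.riemannZetaNontrivialZeros := by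
    intro ρ hρ
    obtain ⟨p, -, rfl⟩ := Finset.mem_image.1 hρ
    exact p.2.1
  -- the weight `P_R` and its four properties
  set P : ℂ → ℂ := fun z : ℂ ↦ ∏ ρ ∈ R, (z - ρ) ^ (riemannZetaZeroOrder ρ).toNat with hPdef
  have hPa : ∀ s, AnalyticAt ℂ P s := fun s ↦ (differentiable_weight R).analyticAt s
  have hPn : ∀ z : ℂ, ‖P z‖ ≤ (∏ ρ ∈ R, (1 + ‖ρ‖) ^ (riemannZetaZeroOrder ρ).toNat) *
      (1 + ‖z‖) ^ (∑ ρ ∈ R, (riemannZetaZeroOrder ρ).toNat) := fun z ↦ norm_weight_le R z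
  have hP2 : ∀ s : ℂ, 2 ≤ s.re → P s ≠ 0 := fun s hs ↦ weight_ne_zero hR (by linarith)
  have hPR : ∀ ρ ∈ R, (((riemannZetaZeroOrder ρ).toNat : ℤ) : WithTop ℤ) ≤ meromorphicOrderAt P ρ :=
    fun ρ hρ ↦ le_meromorphicOrderAt_weight hρ
  have hNa : (∑ ρ ∈ R, (riemannZetaZeroOrder ρ).toNat) = 0 ∨ 1 < a := by
    rcases hSa with h | h
    · left; rw [hRdef, h]; simp
    · exact Or.inr h
  obtain ⟨v, hvg⟩ := BurnolEvaluators.exists_conj g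
  have hv : v ∈ sonineL a := BurnolEvaluators.mem_sonineL_of_conj hg hvg
  have hvan : ∀ ρ ∈ ZetaZeros.riemannZetaNontrivialZeros, ρ ∉ R →
      (((riemannZetaZeroOrder ρ).toNat : ℕ) : ℕ∞) ≤ analyticOrderAt (rightMellinExt v) ρ := by
    intro ρ hρ hρR
    refine le_analyticOrderAt_of_burnolEval_eq_zero ha hv hρ fun k hk ↦ ?_
    let p : ZetaZeroIndex := ⟨(ρ, k), hρ, hk⟩
    have hpS : p ∉ S := fun hpS ↦ hρR (Finset.mem_image.2 ⟨p, hpS, rfl⟩)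
    exact burnolEval_conj_eq_zero ha hg hvg p (horth p hpS)
  have hG := rightMellinExt_eq_zero_of_vanishing ha1 hv hPa (weightConst_pos R).le hPn hP2 hNa R
    hPR hvan
  exact eq_zero_of_conj_eq_zero hvg (eq_zero_of_rightMellinExt_eq_zero ha1 hv hG)

/-- **Completeness from the orthogonality criterion** (orthogonal projection onto the closed span
inside the closed subspace `L_a`). [cite: Burnol2004b, Props. 6.1–6.2 (arXiv:math/0203120v7 p. 15, TeX l.1203–1257)] -/
theorem sonineL_subset_closure_span (ha1 : 1 ≤ a) (S : Finset ZetaZeroIndex) (hSa : S = ∅ ∨ 1 < a) :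
    sonineL a ⊆ closure (Submodule.span ℂ
      (Set.range fun p : {p : ZetaZeroIndex // p ∉ S} ↦ burnolYSystem a p.1) :
        Set (Lp ℂ 2 (volume : Measure ℝ))) := by
  intro g hg
  have ha : 0 < a := by linarith
  set W : Submodule ℂ (Lp ℂ 2 (volume : Measure ℝ)) :=
    Submodule.span ℂ (Set.range fun p : {p : ZetaZeroIndex // p ∉ S} ↦ burnolYSystem a p.1) with hW
  set V : Submodule ℂ (Lp ℂ 2 (volume : Measure ℝ)) := W.topologicalClosure with hV
  -- `L_a` as a submodule, and `V ⊆ L_a`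
  let L : Submodule ℂ (Lp ℂ 2 (volume : Measure ℝ)) :=
    { carrier := sonineL a
      add_mem' := fun hf hg ↦ BurnolEvaluators.add_mem_sonineL hf hg
      zero_mem' := BurnolEvaluators.zero_mem_sonineL
      smul_mem' := fun c _ hf ↦ BurnolEvaluators.smul_mem_sonineL c hf }
  have hWL : W ≤ L := by
    refine Submodule.span_le.2 ?_
    rintro _ ⟨p, rfl⟩
    exact (BurnolEvaluators.isBurnolY_burnolYSystem ha p.1).1
  have hVL : (V : Set (Lp ℂ 2 (volume : Measure ℝ))) ⊆ sonineL a := by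
    rw [hV, Submodule.topologicalClosure_coe]
    exact (BurnolEvaluators.isClosed_sonineL a).closure_subset_iff.2 hWL
  haveI : CompleteSpace V := (Submodule.isClosed_topologicalClosure W).completeSpace_coe
  -- orthogonal decomposition of `g` along `V`
  set u : Lp ℂ 2 (volume : Measure ℝ) := V.starProjection g with hu
  have huV : u ∈ V := V.starProjection_apply_mem g
  have hw : g - u ∈ Vᗮ := V.sub_starProjection_mem_orthogonal g
  have hwL : g - u ∈ sonineL a := BurnolEvaluators.sub_mem_sonineL hg (hVL huV)
  have horth : ∀ p : ZetaZeroIndex, p ∉ S → inner ℂ (burnolYSystem a p) (g - u) = 0 := by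
    intro p hp
    refine (Submodule.mem_orthogonal V (g - u)).1 hw _ ?_
    exact W.le_topologicalClosure (Submodule.subset_span ⟨⟨p, hp⟩, rfl⟩)
  have h0 := eq_zero_of_orthogonal ha1 S hSa hwL horth
  have hgu : g = u := sub_eq_zero.1 h0
  rw [hgu, ← Submodule.topologicalClosure_coe]
  exact huV

/-- There is an index: a non-trivial zero exists (Hardy's theorem, on the critical line), with
multiplicity `≥ 1`. [cite: Hardy1914, C. R. Acad. Sci. Paris 158 (1914) 1012–1014 (proof: Titchmarsh1986 §10.2)] -/
theorem nonempty_zetaZeroIndex : Nonempty ZetaZeroIndex := by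
  obtain ⟨t, ht⟩ := Hardy.riemannZeta_zeros_on_critical_line_infinite.nonempty
  have hρ : (1 / 2 + t * I : ℂ) ∈ ZetaZeros.riemannZetaNontrivialZeros :=
    mem_riemannZetaNontrivialZeros_iff_holds.2 ⟨ht, by simp, by norm_num⟩
  exact ⟨⟨(1 / 2 + t * I, 0), hρ, by
    have := ZetaZeros.riemannZetaNontrivialZeros.one_le_order hρ; push_cast; omega⟩⟩

end Completeness

end BurnolEvaluatorCompleteness

/-! ## The two discharges -/

/-- **Burnol 2004b, Prop. 6.1, PROVED**: "Let `a ≥ 1`. The vectors `Y^a_{ρ,k}` associated with the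
non-trivial zeros of the Riemann zeta function are complete in `L_a`." Discharge of the named fact
`Burnol2004b_prop6_1`. Printed proof: `G(s) = ζ(s)θ(s)` with `θ` entire, Nevanlinna in two
half-planes, of exponential type `< 0` for `a > 1` by Kreĭn's theorem, minimal type + `L²` on a line
for `a = 1`. DECLARED DEVIATION: Kreĭn's theorem is replaced by Titchmarsh's Theorem 9.7 (good heights,
`|1/ζ| ≤ T^A`) + the maximum modulus principle on rectangles + Liouville's theorem for polynomial growth;
the conclusion is the printed one. [cite: Burnol2004b, Prop. 6.1 (arXiv:math/0203120v7 p. 15, TeX l.1203–1239)] -/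
theorem Burnol2004b_prop6_1_holds : Burnol2004b_prop6_1 := by
  intro a ha1
  refine ⟨fun p ↦ (BurnolEvaluators.isBurnolY_burnolYSystem (by linarith) p).1, ?_⟩
  have h := BurnolEvaluatorCompleteness.sonineL_subset_closure_span ha1 ∅ (Or.inl rfl)
  have hr : (Set.range fun p : {p : ZetaZeroIndex // p ∉ (∅ : Finset ZetaZeroIndex)} ↦
      burnolYSystem a p.1) = Set.range (burnolYSystem a) := by
    ext x
    constructor
    · rintro ⟨p, rfl⟩; exact ⟨p.1, rfl⟩
    · rintro ⟨p, rfl⟩; exact ⟨⟨p, by simp⟩, rfl⟩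
  rwa [hr] at h

/-- **Burnol 2004b, Prop. 6.2, PROVED**: "Let `a > 1`. The vectors `Y^a_{ρ,k}` associated with the
non-trivial zeros of the Riemann zeta function are not minimal: indeed they remain a complete system in
`L_a` even after omitting arbitrarily finitely many among them." Discharge of the named fact
`Burnol2004b_prop6_2` (same engine with the polynomial weight `∏_{ρ∈R}(s−ρ)^{m_ρ}`, as printed,
TeX l.1249–1256; Kreĭn's type formula replaced as in Prop. 6.1). Non-minimality: completeness after
omitting one vector (an index exists by Hardy's theorem). [cite: Burnol2004b, Prop. 6.2 (arXiv:math/0203120v7 p. 15, TeX l.1241–1257)] -/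
theorem Burnol2004b_prop6_2_holds : Burnol2004b_prop6_2 := by
  intro a ha
  have ha1 : 1 ≤ a := ha.le
  have ha0 : 0 < a := by linarith
  have hcomplete : ∀ S : Finset ZetaZeroIndex, IsCompleteSystemIn (sonineL a)
      (fun p : {p : ZetaZeroIndex // p ∉ S} ↦ burnolYSystem a p.1) := fun S ↦
    ⟨fun p ↦ (BurnolEvaluators.isBurnolY_burnolYSystem ha0 p.1).1,
      BurnolEvaluatorCompleteness.sonineL_subset_closure_span ha1 S (Or.inr ha)⟩
  refine ⟨fun hmin ↦ ?_, hcomplete⟩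
  obtain ⟨i₀⟩ := BurnolEvaluatorCompleteness.nonempty_zetaZeroIndex
  have h := (hcomplete {i₀}).2 (BurnolEvaluators.isBurnolY_burnolYSystem ha0 i₀).1
  apply hmin i₀
  have hr : (Set.range fun p : {p : ZetaZeroIndex // p ∉ ({i₀} : Finset ZetaZeroIndex)} ↦
      burnolYSystem a p.1) = burnolYSystem a '' {j | j ≠ i₀} := by
    ext x
    constructor
    · rintro ⟨p, rfl⟩
      exact ⟨p.1, by simpa [Finset.mem_singleton] using p.2, rfl⟩
    · rintro ⟨j, hj, rfl⟩
      exact ⟨⟨j, by simpa [Finset.mem_singleton] using hj⟩, rfl⟩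
  rwa [hr] at h

end Literature.NumberTheory.LFunctions

end


/-! ## Appendix: the strip bound from EDGE data only (support for the `0 < a < 1` perp computation of
Thm. 3.1 (3), where `G_f` is unbounded on the right half-plane but bounded on the line `Re s = 2`) -/

noncomputable section

open Complex Filter Set Topology MeasureTheory Bornology Metric
open scoped Real

namespace Literature.NumberTheory.LFunctions

namespace BurnolEvaluatorCompleteness

section StripEdges

variable {a : ℝ} {f : Lp ℂ 2 (volume : Measure ℝ)} {P : ℂ → ℂ} {CP : ℝ} {N : ℕ} {θ : ℂ → ℂ}

/-- **A priori polynomial bound in the strip `−1 ≤ Re s ≤ 2` from EDGE data** (every `a > 0`): the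
same maximum-modulus argument between consecutive good heights of Titchmarsh's Theorem 9.7 as
`exists_bound_theta_strip`, with the hypotheses restricted to what the proof uses — the weight bound
on the closed strip and the bounds for `θ` on the two LINES `Re s = 2`, `Re s = −1` (on the latter off
the zeros of `ζ`, of which there are none). [cite: Titchmarsh1986, Thm. 9.7; Burnol2004b, Thm. 4.8 (arXiv:math/0203120v7 p. 9)] -/
theorem exists_bound_theta_strip_of_edges (ha : 0 < a) (hf : f ∈ sonineL a) (hθd : Differentiable ℂ θ)
    (hCP : 0 ≤ CP) (hPn : ∀ z : ℂ, -1 ≤ z.re → z.re ≤ 2 → ‖P z‖ ≤ CP * (1 + ‖z‖) ^ N)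
    (hθ : ∀ s, s ≠ 1 → riemannZeta s ≠ 0 →
      θ s = rightMellinExt f s * P s / riemannZeta s)
    {C₁ : ℝ} (hC₁0 : 0 ≤ C₁) (hC₁ : ∀ s : ℂ, s.re = 2 → ‖θ s‖ ≤ C₁ * (1 + ‖s‖) ^ N)
    {C₂ : ℝ} (hC₂0 : 0 ≤ C₂)
    (hC₂ : ∀ s : ℂ, s.re = -1 → riemannZeta s ≠ 0 → ‖θ s‖ ≤ C₂ * (1 + ‖s‖) ^ N) :
    ∃ C : ℝ, 0 ≤ C ∧ ∃ M : ℕ, N ≤ M ∧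
      ∀ s : ℂ, -1 ≤ s.re → s.re ≤ 2 → ‖θ s‖ ≤ C * (1 + ‖s‖) ^ M := by
  set G := rightMellinExt f with hGdef
  -- Titchmarsh 9.7 and the L-Property
  obtain ⟨A, hA0, T₀, hT₀8, hgood⟩ := InvZetaPoly.exists_norm_inv_zeta_le_rpow
  obtain ⟨CL, T₁, hL⟩ := Burnol2004b_thm4_8_holds a ha f hf (-1) 2 1 (by norm_num) one_pos
  have hexp : max (1 / 2 - (-1 : ℝ)) 0 + 1 = 5 / 2 := by norm_num
  set K : ℕ := ⌈A⌉₊ with hK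
  have hAK : A ≤ K := Nat.le_ceil A
  set M : ℕ := N + K + 3 with hM
  set CL' : ℝ := max CL 0 with hCL'
  -- the horizontal bound at a good height
  set Ch : ℝ := CL' * (CP * 3 ^ N) with hCh
  have hCh0 : 0 ≤ Ch := by positivity
  have horiz : ∀ T : ℝ, max T₀ |T₁| ≤ T →
      (∀ σ ∈ Icc (-1 : ℝ) 2, ‖(riemannZeta (σ + T * I))⁻¹‖ ≤ T ^ A ∧
        ‖(riemannZeta (σ - T * I))⁻¹‖ ≤ T ^ A) →
      ∀ z : ℂ, z.re ∈ Icc (-1 : ℝ) 2 → |z.im| = T → ‖θ z‖ ≤ Ch * (1 + T) ^ M := by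
    intro T hT hb z hzre hzim
    have hT8 : 8 ≤ T := hT₀8.trans ((le_max_left _ _).trans hT)
    have hT0 : 0 < T := by linarith
    have hT1 : T₁ ≤ |z.im| := by rw [hzim]; exact (le_abs_self _).trans ((le_max_right _ _).trans hT)
    -- `ζ z ≠ 0` and `‖1/ζ z‖ ≤ T^A`
    have hplus : ∀ σ ∈ Icc (-1 : ℝ) 2, ‖(riemannZeta (σ + T * I))⁻¹‖ ≤ T ^ A := fun σ hσ ↦ (hb σ hσ).1
    have hminus : ∀ σ ∈ Icc (-1 : ℝ) 2, ‖(riemannZeta (σ + ((-T : ℝ) : ℂ) * I))⁻¹‖ ≤ T ^ A := by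
      intro σ hσ
      have e : (σ : ℂ) + ((-T : ℝ) : ℂ) * I = σ - T * I := by push_cast; ring
      rw [e]; exact (hb σ hσ).2
    have hz : z = (z.re : ℂ) + (z.im : ℂ) * I := (re_add_im z).symm
    have hζinv : riemannZeta z ≠ 0 ∧ ‖(riemannZeta z)⁻¹‖ ≤ T ^ A := by
      rcases (abs_eq hT0.le).1 hzim with h | h
      · rw [hz, h]
        exact ⟨zeta_ne_zero_of_norm_inv_le hT0.ne' hplus z.re hzre, hplus z.re hzre⟩
      · rw [hz, h]
        exact ⟨zeta_ne_zero_of_norm_inv_le (neg_ne_zero.2 hT0.ne') hminus z.re hzre,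
          hminus z.re hzre⟩
    have hz1 : z ≠ 1 := by
      intro h1; rw [h1, one_im, abs_zero] at hzim; linarith
    -- the three factors
    have hGz : ‖G z‖ ≤ CL' * (1 + T) ^ 3 := by
      have h1 := hL z.re z.im hzre.1 hzre.2 hT1
      rw [← hz, hexp, hzim] at h1
      refine h1.trans ?_
      have h1T : 1 ≤ 1 + T := by linarith
      calc CL * (1 + T) ^ (5 / 2 : ℝ) ≤ CL' * (1 + T) ^ (5 / 2 : ℝ) :=
            mul_le_mul_of_nonneg_right (le_max_left _ _) (by positivity)
        _ ≤ CL' * (1 + T) ^ ((3 : ℕ) : ℝ) :=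
            mul_le_mul_of_nonneg_left (Real.rpow_le_rpow_of_exponent_le h1T (by norm_num))
              (le_max_right _ _)
        _ = CL' * (1 + T) ^ 3 := by rw [Real.rpow_natCast]
    have hnz : ‖z‖ ≤ 2 + T := by
      calc ‖z‖ ≤ |z.re| + |z.im| := norm_le_abs_re_add_abs_im z
        _ ≤ 2 + T := by
          rw [hzim]; have := abs_le.2 (And.intro (by linarith [hzre.1]) hzre.2); linarith
    have hPz : ‖P z‖ ≤ CP * 3 ^ N * (1 + T) ^ N := by
      refine (hPn z hzre.1 hzre.2).trans ?_
      rw [mul_assoc, ← mul_pow]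
      refine mul_le_mul_of_nonneg_left (pow_le_pow_left₀ (by positivity) (by linarith) N) hCP
    have hζz : ‖(riemannZeta z)⁻¹‖ ≤ (1 + T) ^ K := by
      refine hζinv.2.trans ?_
      calc T ^ A ≤ (1 + T) ^ A := Real.rpow_le_rpow hT0.le (by linarith) hA0.le
        _ ≤ (1 + T) ^ (K : ℝ) := Real.rpow_le_rpow_of_exponent_le (by linarith) hAK
        _ = (1 + T) ^ K := Real.rpow_natCast _ _
    rw [hθ z hz1 hζinv.1, div_eq_mul_inv, norm_mul, norm_mul]
    calc ‖G z‖ * ‖P z‖ * ‖(riemannZeta z)⁻¹‖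
        ≤ CL' * (1 + T) ^ 3 * (CP * 3 ^ N * (1 + T) ^ N) * (1 + T) ^ K := by
          refine mul_le_mul (mul_le_mul hGz hPz (norm_nonneg _) (by positivity)) hζz
            (norm_nonneg _) (by positivity)
      _ = Ch * (1 + T) ^ M := by rw [hCh, hM]; ring
  -- the vertical edges
  set Cv : ℝ := (C₁ + C₂) * 3 ^ N with hCv
  have vert : ∀ z : ℂ, (z.re = -1 ∨ z.re = 2) → ∀ T : ℝ, 0 ≤ T → |z.im| ≤ T →
      ‖θ z‖ ≤ Cv * (1 + T) ^ M := by
    intro z hzre T hT0 hzT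
    have hnz : 1 + ‖z‖ ≤ 3 * (1 + T) := by
      calc 1 + ‖z‖ ≤ 1 + (|z.re| + |z.im|) := by linarith [norm_le_abs_re_add_abs_im z]
        _ ≤ 3 * (1 + T) := by
          rcases hzre with h | h <;> rw [h] <;> norm_num <;> linarith
    have hpow : (1 + ‖z‖) ^ N ≤ 3 ^ N * (1 + T) ^ M := by
      calc (1 + ‖z‖) ^ N ≤ (3 * (1 + T)) ^ N := pow_le_pow_left₀ (by positivity) hnz N
        _ = 3 ^ N * (1 + T) ^ N := mul_pow _ _ _
        _ ≤ 3 ^ N * (1 + T) ^ M :=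
          mul_le_mul_of_nonneg_left (pow_mono_exp hT0 (by rw [hM]; omega)) (by positivity)
    rcases hzre with h | h
    · have hζ : riemannZeta z ≠ 0 := by
        intro h0
        obtain ⟨n, hn⟩ := (riemannZeta_eq_zero_iff_of_re_nonpos (by rw [h]; norm_num)).1 h0
        have := congrArg Complex.re hn
        rw [h] at this; simp at this
        have h2 : (n : ℝ) = -1 / 2 := by linarith
        have h3 : (0 : ℝ) ≤ n := n.cast_nonneg
        linarith
      calc ‖θ z‖ ≤ C₂ * (1 + ‖z‖) ^ N := hC₂ z h hζ
        _ ≤ (C₁ + C₂) * (1 + ‖z‖) ^ N := by gcongr; linarith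
        _ ≤ (C₁ + C₂) * (3 ^ N * (1 + T) ^ M) := mul_le_mul_of_nonneg_left hpow (by positivity)
        _ = Cv * (1 + T) ^ M := by rw [hCv]; ring
    · calc ‖θ z‖ ≤ C₁ * (1 + ‖z‖) ^ N := hC₁ z h
        _ ≤ (C₁ + C₂) * (1 + ‖z‖) ^ N := by gcongr; linarith
        _ ≤ (C₁ + C₂) * (3 ^ N * (1 + T) ^ M) := mul_le_mul_of_nonneg_left hpow (by positivity)
        _ = Cv * (1 + T) ^ M := by rw [hCv]; ring
  -- far from the real axis: rectangles between good heights
  set Tstar : ℝ := max T₀ |T₁| + 2 with hTstar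
  set Cfar : ℝ := (Ch + Cv) * 3 ^ M with hCfar
  have far : ∀ s : ℂ, -1 ≤ s.re → s.re ≤ 2 → Tstar ≤ |s.im| →
      ‖θ s‖ ≤ Cfar * (1 + ‖s‖) ^ M := by
    intro s hs1 hs2 hst
    set t : ℝ := |s.im| with ht
    have ht0 : 0 ≤ t := abs_nonneg _
    -- good heights just below and just above `t`
    obtain ⟨Tlo, hTloI, hTlo⟩ := hgood (t - 2) (by
      have := le_max_left T₀ |T₁|; rw [hTstar] at hst; linarith)
    obtain ⟨Thi, hThiI, hThi⟩ := hgood (t + 1) (by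
      have := le_max_left T₀ |T₁|; rw [hTstar] at hst; linarith)
    have hlo1 : Tlo ≤ t - 1 := by have := hTloI.2; linarith
    have hlo2 : t - 2 ≤ Tlo := hTloI.1
    have hhi1 : t + 1 ≤ Thi := hThiI.1
    have hhi2 : Thi ≤ t + 2 := by have := hThiI.2; linarith
    have hloM : max T₀ |T₁| ≤ Tlo := by rw [hTstar] at hst; linarith
    have hhiM : max T₀ |T₁| ≤ Thi := by rw [hTstar] at hst; linarith
    have hlohi : Tlo < Thi := by linarith
    have hmaxT : T₀ ≤ max T₀ |T₁| := le_max_left _ _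
    have hTlo0 : 0 ≤ Tlo := by linarith
    have hThi0 : 0 ≤ Thi := by linarith
    -- the common bound on the boundary of the rectangle
    set B : ℝ := (Ch + Cv) * (1 + Thi) ^ M with hB
    have hBh : ∀ z : ℂ, z.re ∈ Icc (-1 : ℝ) 2 → (|z.im| = Tlo ∨ |z.im| = Thi) → ‖θ z‖ ≤ B := by
      intro z hz hzT
      rcases hzT with h | h
      · calc ‖θ z‖ ≤ Ch * (1 + Tlo) ^ M := horiz Tlo hloM hTlo z hz h
          _ ≤ Ch * (1 + Thi) ^ M := by gcongr
          _ ≤ B := by rw [hB]; nlinarith [pow_nonneg (by linarith : (0:ℝ) ≤ 1 + Thi) M,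
            mul_nonneg (by positivity : (0:ℝ) ≤ Cv) (pow_nonneg (by linarith : (0:ℝ) ≤ 1 + Thi) M)]
      · calc ‖θ z‖ ≤ Ch * (1 + Thi) ^ M := horiz Thi hhiM hThi z hz h
          _ ≤ B := by rw [hB]; nlinarith [pow_nonneg (by linarith : (0:ℝ) ≤ 1 + Thi) M,
            mul_nonneg (by positivity : (0:ℝ) ≤ Cv) (pow_nonneg (by linarith : (0:ℝ) ≤ 1 + Thi) M)]
    have hBv : ∀ z : ℂ, (z.re = -1 ∨ z.re = 2) → |z.im| ≤ Thi → ‖θ z‖ ≤ B := by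
      intro z hz hzT
      calc ‖θ z‖ ≤ Cv * (1 + Thi) ^ M := vert z hz Thi hThi0 hzT
        _ ≤ B := by rw [hB]; nlinarith [pow_nonneg (by linarith : (0:ℝ) ≤ 1 + Thi) M,
            mul_nonneg hCh0 (pow_nonneg (by linarith : (0:ℝ) ≤ 1 + Thi) M)]
    -- the bound at `s`, by the maximum modulus principle on the rectangle on the correct side
    have hsB : ‖θ s‖ ≤ B := by
      rcases le_or_gt 0 s.im with hpos | hneg
      · have hts : t = s.im := abs_of_nonneg hpos
        refine norm_le_of_rect hθd (x₁ := -1) (x₂ := 2) (y₁ := Tlo) (y₂ := Thi) (by norm_num) hlohi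
          (fun z hz hzim ↦ hBh z hz ?_) (fun z hz hzim ↦ hBv z hz ?_) ⟨hs1, hs2⟩
          ⟨by linarith, by linarith⟩
        · have hz0 : 0 ≤ z.im := by rcases hzim with h | h <;> rw [h] <;> linarith
          rw [abs_of_nonneg hz0]; exact hzim
        · have hz0 : 0 ≤ z.im := by linarith [hzim.1]
          rw [abs_of_nonneg hz0]; exact hzim.2
      · have hts : t = -s.im := abs_of_neg hneg
        refine norm_le_of_rect hθd (x₁ := -1) (x₂ := 2) (y₁ := -Thi) (y₂ := -Tlo) (by norm_num)
          (by linarith) (fun z hz hzim ↦ hBh z hz ?_) (fun z hz hzim ↦ hBv z hz ?_) ⟨hs1, hs2⟩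
          ⟨by linarith, by linarith⟩
        · have hz0 : z.im ≤ 0 := by rcases hzim with h | h <;> rw [h] <;> linarith
          rw [abs_of_nonpos hz0]
          rcases hzim with h | h
          · right; rw [h]; ring
          · left; rw [h]; ring
        · have hz0 : z.im ≤ 0 := by linarith [hzim.2]
          rw [abs_of_nonpos hz0]; linarith [hzim.1]
    -- `B ≤ Cfar (1 + ‖s‖)^M`
    refine hsB.trans ?_
    have h3 : 1 + Thi ≤ 3 * (1 + ‖s‖) := by
      have : t ≤ ‖s‖ := abs_im_le_norm s
      linarith [norm_nonneg s]
    calc B = (Ch + Cv) * (1 + Thi) ^ M := rfl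
      _ ≤ (Ch + Cv) * (3 * (1 + ‖s‖)) ^ M := by gcongr
      _ = Cfar * (1 + ‖s‖) ^ M := by rw [hCfar, mul_pow]; ring
  -- near the real axis: compactness
  set Kc : Set ℂ := Icc (-1 : ℝ) 2 ×ℂ Icc (-Tstar) Tstar with hKc
  have hKcpt : IsCompact Kc := isCompact_Icc.reProdIm isCompact_Icc
  obtain ⟨M₀, hM₀⟩ := hKcpt.exists_bound_of_continuousOn hθd.continuous.continuousOn
  -- assembly
  refine ⟨max M₀ 0 + Cfar, by positivity, M, by rw [hM]; omega, fun s hs1 hs2 ↦ ?_⟩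
  have h1 : 1 ≤ (1 + ‖s‖) ^ M := one_le_pow₀ (by linarith [norm_nonneg s])
  have hCfar0 : 0 ≤ Cfar := by positivity
  rcases le_or_gt Tstar |s.im| with hfar | hnear
  · calc ‖θ s‖ ≤ Cfar * (1 + ‖s‖) ^ M := far s hs1 hs2 hfar
      _ ≤ (max M₀ 0 + Cfar) * (1 + ‖s‖) ^ M := by gcongr; linarith [le_max_right M₀ 0]
  · have hsK : s ∈ Kc := ⟨⟨hs1, hs2⟩, abs_le.1 hnear.le⟩
    calc ‖θ s‖ ≤ M₀ := hM₀ s hsK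
      _ ≤ max M₀ 0 * 1 := by rw [mul_one]; exact le_max_left _ _
      _ ≤ (max M₀ 0 + Cfar) * (1 + ‖s‖) ^ M :=
          mul_le_mul (by linarith) h1 zero_le_one (by positivity)

end StripEdges

end BurnolEvaluatorCompleteness

end Literature.NumberTheory.LFunctions

end
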